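/-
Copyright (c) 2026 the pub-hodgecm-mathlib formalisation cell (harness21).  Prover seat hodgecm-mathlib-F0P3-p01 (g19): road «S3-ram», (Cnt2′) BLOCK LAW, the JOINT pm cell of
regimes A-odd ∕ C `stub_Zpair_pm_odd_A` (chair F0P3a-p07 (g15) RULING (18)(1): assembler) — CLOSED over the ★ heads of F0P3a-p01 (g18), F0P3a-p08 (g20∕g21), A-p16 (g33),
F0P2-p01 (g17), F0P3a-p02 (g18), A-p19 (g29), the chair, and this seat; 2026-09-02.
-/
import Literature.NumberTheory.Rogawski1990.DepthZeroKappaTransferTypeTwoRamifiedHyperbolicRootCensusParams   -- ★ p849618 (F0P3a-p01 (g18)): `BlockLawHyp.hyperbolicRootCensus_params_odd_ram`; brings ★ p849335 (⊃ ★ p849291, CM dress), ★ A-p19 frame literal, ★ p849319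
import Literature.NumberTheory.Rogawski1990.DepthZeroKappaTransferTypeTwoRamifiedAnisotropicRootCensusParams  -- ★ p849702 (A-p16 (g33)): `BlockLawAniso.anisotropicRootCensus_params_odd_ram` (over ★ p849644 ∕ p849483 ∕ p849383)
import Literature.NumberTheory.Rogawski1990.DepthZeroKappaTransferTypeTwoRamifiedBlockRootCensusIotaShape     -- ★ p849534 (F0P3a-p02 (g18)): ι-shape adapter; brings ★ p849444 block-frame finite law
import Literature.NumberTheory.Rogawski1990.DepthZeroKappaTransferTypeTwoRamifiedBlockRootCensusRelations     -- ★ p849473 (this seat): `crossLiteral_lineRelations'`, frame-sign lemmas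
import Literature.NumberTheory.Rogawski1990.DepthZeroKappaTransferTypeTwoRamifiedSpectralTieResidual         -- ★ p849471 (chair F0P3a-p07 (g15)): `SpectralTie.trace_det_centred_blocks_agree_ram`, block-frame glue
import Literature.NumberTheory.Automorphic.LineStrataMeasure                                                   -- ★ `red_ne_zero_iff_valuation_eq_one`
import Literature.NumberTheory.QuadraticForms.HilbertSymbol                                                    -- ★ `hilbertSymbol_eq_one_or_eq_neg_one`
import HarnessLib

set_option autoImplicit false

noncomputable section

open NumberField IsDedekindDomain Matrix Polynomial ValuativeRel
open Literature.NumberTheory.Automorphic Literature.NumberTheory.Automorphic.UnitaryGroup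
open Literature.NumberTheory.Automorphic.IntegralReduction Literature.NumberTheory.GaloisRepresentations
open Literature.NumberTheory.NumberFields Literature.NumberTheory.QuadraticForms
open Literature.GroupTheory.SpecificGroups Literature.NumberTheory.Automorphic.UnitaryLatticeTree
open Literature.NumberTheory.Automorphic.HermitianLattice Literature.NumberTheory.Rogawski1990.TypeOneRamifiedJunction
open Literature.NumberTheory.Rogawski1990 Literature.NumberTheory.Rogawski1990.TypeTwoBlockRoot
open scoped Matrix MatrixGroups ValuativeRel WithZero

namespace Literature.NumberTheory.Rogawski1990.BlockLawPair


/-! ## §0 Generic helpers (traces under the `ι`-embedding and conjugation; integral leading matrices; the bookkeeping) -/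

/-- Conjugation by `P` and the `ι`-embedding with trivial `1 × 1` block do not change `tr(· − 1)` and `tr((· − 1)²)`. [cite: Rogawski1990, §4.9 p. 55] -/
theorem trace_coe_conj_endoGL_one_sub_one {K : Type*} [Field K] (P : GL (Fin 3) K) (g : GL (Fin 2) K) :
    (((P * endoGL (g, (1 : GL (Fin 1) K)) * P⁻¹ : GL (Fin 3) K) : Matrix (Fin 3) (Fin 3) K) - 1).trace = ((g : Matrix (Fin 2) (Fin 2) K) - 1).trace ∧
    ((((P * endoGL (g, (1 : GL (Fin 1) K)) * P⁻¹ : GL (Fin 3) K) : Matrix (Fin 3) (Fin 3) K) - 1) * (((P * endoGL (g, (1 : GL (Fin 1) K)) * P⁻¹ : GL (Fin 3) K) : Matrix (Fin 3) (Fin 3) K) - 1)).trace = (((g : Matrix (Fin 2) (Fin 2) K) - 1) * ((g : Matrix (Fin 2) (Fin 2) K) - 1)).trace := by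
  have e : (((P * endoGL (g, (1 : GL (Fin 1) K)) * P⁻¹ : GL (Fin 3) K) : Matrix (Fin 3) (Fin 3) K) - 1) = (P : Matrix (Fin 3) (Fin 3) K) * (((endoGL (g, (1 : GL (Fin 1) K)) : GL (Fin 3) K) : Matrix (Fin 3) (Fin 3) K) - 1) * ((P⁻¹ : GL (Fin 3) K) : Matrix (Fin 3) (Fin 3) K) := by
    rw [Matrix.mul_sub, Matrix.sub_mul, Matrix.mul_one, Units.mul_inv, Units.val_mul, Units.val_mul]
  have hPP : ((P⁻¹ : GL (Fin 3) K) : Matrix (Fin 3) (Fin 3) K) * (P : Matrix (Fin 3) (Fin 3) K) = 1 := Units.inv_mul P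
  have hE : ((endoGL (g, (1 : GL (Fin 1) K)) : GL (Fin 3) K) : Matrix (Fin 3) (Fin 3) K) - 1 =
      !![((g : Matrix (Fin 2) (Fin 2) K) - 1) 0 0, 0, ((g : Matrix (Fin 2) (Fin 2) K) - 1) 0 1; 0, (0 : K), 0; ((g : Matrix (Fin 2) (Fin 2) K) - 1) 1 0, 0, ((g : Matrix (Fin 2) (Fin 2) K) - 1) 1 1] := by
    rw [coe_endoGL_sub_one_eq_endoShape, Units.val_one, Matrix.one_apply_eq, sub_self]
  have e2 : (P : Matrix (Fin 3) (Fin 3) K) * (((endoGL (g, (1 : GL (Fin 1) K)) : GL (Fin 3) K) : Matrix (Fin 3) (Fin 3) K) - 1) * ((P⁻¹ : GL (Fin 3) K) : Matrix (Fin 3) (Fin 3) K) * ((P : Matrix (Fin 3) (Fin 3) K) * (((endoGL (g, (1 : GL (Fin 1) K)) : GL (Fin 3) K) : Matrix (Fin 3) (Fin 3) K) - 1) * ((P⁻¹ : GL (Fin 3) K) : Matrix (Fin 3) (Fin 3) K)) = (P : Matrix (Fin 3) (Fin 3) K) * ((((endoGL (g, (1 : GL (Fin 1) K)) : GL (Fin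 3) K) : Matrix (Fin 3) (Fin 3) K) - 1) * (((endoGL (g, (1 : GL (Fin 1) K)) : GL (Fin 3) K) : Matrix (Fin 3) (Fin 3) K) - 1)) * ((P⁻¹ : GL (Fin 3) K) : Matrix (Fin 3) (Fin 3) K) := by
    calc (P : Matrix (Fin 3) (Fin 3) K) * (((endoGL (g, (1 : GL (Fin 1) K)) : GL (Fin 3) K) : Matrix (Fin 3) (Fin 3) K) - 1) * ((P⁻¹ : GL (Fin 3) K) : Matrix (Fin 3) (Fin 3) K) * ((P : Matrix (Fin 3) (Fin 3) K) * (((endoGL (g, (1 : GL (Fin 1) K)) : GL (Fin 3) K) : Matrix (Fin 3) (Fin 3) K) - 1) * ((P⁻¹ : GL (Fin 3) K) : Matrix (Fin 3) (Fin 3) K))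
        = (P : Matrix (Fin 3) (Fin 3) K) * (((endoGL (g, (1 : GL (Fin 1) K)) : GL (Fin 3) K) : Matrix (Fin 3) (Fin 3) K) - 1) * (((P⁻¹ : GL (Fin 3) K) : Matrix (Fin 3) (Fin 3) K) * (P : Matrix (Fin 3) (Fin 3) K)) * (((endoGL (g, (1 : GL (Fin 1) K)) : GL (Fin 3) K) : Matrix (Fin 3) (Fin 3) K) - 1) * ((P⁻¹ : GL (Fin 3) K) : Matrix (Fin 3) (Fin 3) K) := by simp only [Matrix.mul_assoc]
      _ = (P : Matrix (Fin 3) (Fin 3) K) * ((((endoGL (g, (1 : GL (Fin 1) K)) : GL (Fin 3) K) : Matrix (Fin 3) (Fin 3) K) - 1) * (((endoGL (g, (1 : GL (Fin 1) K)) : GL (Fin 3) K) : Matrix (Fin 3) (Fin 3) K) - 1)) * ((P⁻¹ : GL (Fin 3) K) : Matrix (Fin 3) (Fin 3) K) := by rw [hPP, Matrix.mul_one]; simp only [Matrix.mul_assoc]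
  refine ⟨?_, ?_⟩
  · rw [e, Matrix.trace_mul_cycle, hPP, Matrix.one_mul, hE, Matrix.trace_fin_three, Matrix.trace_fin_two]
    simp
  · rw [e, e2, Matrix.trace_mul_cycle, hPP, Matrix.one_mul, hE, endoShape_mul_endoShape, Matrix.trace_fin_three, Matrix.trace_fin_two]
    simp

/-- An integral leading matrix `Y = t·M` (entrywise, `3 × 3`): `↑(tr Y) = t·tr M`, `↑(tr Y²) = t²·tr M²`. [cite: Rogawski1990, §4.9 p. 55] -/
theorem coe_trace_fin_three_of_leading {K : Type*} [Field K] [Valued K ℤᵐ⁰] (t : K) (M : Matrix (Fin 3) (Fin 3) K) (Y : Matrix (Fin 3) (Fin 3) (Valued.integer K))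
    (hY : ∀ i j, ((Y i j : Valued.integer K) : K) = t * M i j) :
    ((Y.trace : Valued.integer K) : K) = t * M.trace ∧ (((Y * Y).trace : Valued.integer K) : K) = t ^ 2 * (M * M).trace := by
  rw [Matrix.trace_fin_three, Matrix.trace_fin_three, Matrix.trace_fin_three, Matrix.trace_fin_three]
  simp only [Matrix.mul_apply, Fin.sum_univ_three]
  push_cast
  simp only [hY]
  constructor <;> ring

/-- An integral leading matrix `Y = t·M` (entrywise, `2 × 2`): `↑(tr Y) = t·tr M`, `↑(tr Y²) = t²·tr M²`. [cite: Rogawski1990, §4.9 p. 55] -/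
theorem coe_trace_fin_two_of_leading {K : Type*} [Field K] [Valued K ℤᵐ⁰] (t : K) (M : Matrix (Fin 2) (Fin 2) K) (Y : Matrix (Fin 2) (Fin 2) (Valued.integer K))
    (hY : ∀ i j, ((Y i j : Valued.integer K) : K) = t * M i j) :
    ((Y.trace : Valued.integer K) : K) = t * M.trace ∧ (((Y * Y).trace : Valued.integer K) : K) = t ^ 2 * (M * M).trace := by
  rw [Matrix.trace_fin_two, Matrix.trace_fin_two, Matrix.trace_fin_two, Matrix.trace_fin_two]
  simp only [Matrix.mul_apply, Fin.sum_univ_two]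
  push_cast
  simp only [hY]
  constructor <;> ring

/-- `tr (Y.map f) = f (tr Y)` for a ring map `f`. [cite: Rogawski1990, §4.9 p. 55] -/
theorem trace_map_residue {R S : Type*} [CommRing R] [CommRing S] {n : Type*} [Fintype n] (f : R →+* S) (Y : Matrix n n R) :
    (Y.map f).trace = f Y.trace := by
  simp only [Matrix.trace, Matrix.diag, Matrix.map_apply, _root_.map_sum]

/-- **The bookkeeping of the pair cell**: favourable root `(2q, F±)`, unfavourable root `(0, U±)`, `U± − F± = q`. [cite: Rogawski1990, §4.9 Prop. 4.9.1 (a) p. 55] -/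
theorem pair_bookkeeping {q n0f cPf cMf n0u cPu cMu : ℕ} {qC X Z Fp Fm Up Um : ℂ} {P : Prop} {_inst : Decidable P} (hq : (q : ℂ) = qC)
    (hFp : Fp = ((q * n0f : ℕ) : ℂ) * X + (if P then ((q * cPf : ℕ) : ℂ) else ((q * cMf : ℕ) : ℂ)) * Z)
    (hFm : Fm = ((q * n0f : ℕ) : ℂ) * X + (if P then ((q * cMf : ℕ) : ℂ) else ((q * cPf : ℕ) : ℂ)) * Z)
    (hUp : Up = ((q * n0u : ℕ) : ℂ) * X + (if P then ((q * cPu : ℕ) : ℂ) else ((q * cMu : ℕ) : ℂ)) * Z)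
    (hUm : Um = ((q * n0u : ℕ) : ℂ) * X + (if P then ((q * cMu : ℕ) : ℂ) else ((q * cPu : ℕ) : ℂ)) * Z)
    (h0f : n0f = 2) (h0u : n0u = 0) (hP : cPu = cPf + 1) (hM : cMu = cMf + 1) :
    ∃ NE FP FM UP UM : ℕ, (Fp = (NE : ℂ) * X + (FP : ℂ) * Z ∧ Fm = (NE : ℂ) * X + (FM : ℂ) * Z ∧ Up = (UP : ℂ) * Z ∧ Um = (UM : ℂ) * Z) ∧
      (NE : ℂ) = 2 * qC ∧ (UP : ℂ) - (FP : ℂ) = qC ∧ (UM : ℂ) - (FM : ℂ) = qC := by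
  subst h0f h0u hP hM hq
  by_cases hp : P
  · refine ⟨q * 2, q * cPf, q * cMf, q * (cPf + 1), q * (cMf + 1), ⟨?_, ?_, ?_, ?_⟩, ?_, ?_, ?_⟩
    · rw [hFp, if_pos hp]
    · rw [hFm, if_pos hp]
    · rw [hUp, if_pos hp]; push_cast; ring
    · rw [hUm, if_pos hp]; push_cast; ring
    · push_cast; ring
    · push_cast; ring
    · push_cast; ring
  · refine ⟨q * 2, q * cMf, q * cPf, q * (cMf + 1), q * (cPf + 1), ⟨?_, ?_, ?_, ?_⟩, ?_, ?_, ?_⟩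
    · rw [hFp, if_neg hp]
    · rw [hFm, if_neg hp]
    · rw [hUp, if_neg hp]; push_cast; ring
    · rw [hUm, if_neg hp]; push_cast; ring
    · push_cast; ring
    · push_cast; ring
    · push_cast; ring

/-! ## §1 The pair cell -/

set_option maxHeartbeats 1600000 in
/-- **THE KEEPER'S JOINT pm CELL `stub_Zpair_pm_odd_A`, CLOSED** (regime A-odd ∕ C: `m = N = 2n+1 = 2mA+3`; rows `1±`; BOTH block literals — the hyperbolic `ι(ĝ_w, û_w)` and the
anisotropic `P₁·ι(γ₁, û_w)·P₁⁻¹`; class constant `c` with `red c · red(−det Φ_{H′,w}) = 1`). Statement = keeper v2.3 text VERBATIM (idle `hH' hA hframe` `_`-prefixed). The favourable root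
(`(β,θ)_v = 1` ⟺ hyperbolic) carries `NE = 2q` null children and `F±`, the other root `0` and `U± = F± + q`.
Proof = ★ p849618 ∘ ★ p849335 (hyperbolic root census ∕ socket totals) ⊕ ★ p849702 ∘ ★ p849291 (anisotropic twin) ⊕ ★ p849534 ∕ ★ p849444 (the finite conic laws at the two
residual matrices) ⊕ ★ p849471 + conjugation invariance (spectral tie: `tr Ȳa = tr Ȳh`, `tr Ȳa² = tr Ȳh²`, hence equal `J`-sums, `χ(δ₀δ₂·det′) = −χ(det Ȳh_W)` via `χ(η̄) = −1`)
⊕ ★ `crossLiteral_lineRelations'` ⊕ `pair_bookkeeping`. [cite: Rogawski1990, §4.9 Prop. 4.9.1 (a) p. 55] [cite: Kottwitz1986, §3] -/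
theorem zpair_pm_odd_A_ram
    (L : Type) [Field L] [NumberField L] [IsCMField L] (H' : Matrix (Fin 3) (Fin 3) L)
    {v : HeightOneSpectrum (𝓞 ↥(maximalRealSubfield L))}
    (_hH' : (H'.map (cmConjRingHom L)).transpose = H') (w : PlacesOver L v)
    (hw : IsCMField.complexConj L • w.1 = w.1) (he : v.asIdeal.ramificationIdx' w.1.asIdeal ≠ 1)
    (hH'w : IsUnit (placeForm H' w.1)) (_hH'i : hH'w.unit ∈ glInt 3 (w.1.adicCompletion L))
    (h2 : IsUnit (2 : 𝒪[(w.1.adicCompletion L)]))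
    (ϖ : w.1.adicCompletion L) (hϖ : Valued.v ϖ = WithZero.exp (-1 : ℤ)) (hσϖ : galAdicCompletionMap (L := L) (IsCMField.complexConj L) hw ϖ = -ϖ)
    (A : GL (Fin 3) (w.1.adicCompletion L)) (_hA : A ∈ glInt 3 (w.1.adicCompletion L))
    (_hframe : placeForm H' w.1 = (-(placeForm H' w.1).det) • formCongr (galAdicCompletionMap (L := L) (IsCMField.complexConj L) hw) A ((StdForm.antidiagonal 3).over (w.1.adicCompletion L))) :

    ∀ (c : (w.1.adicCompletion L)), Valued.v c ≤ 1 → red c * red (-((placeForm H' w.1)).det) = 1 →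
      ∀ ⦃γH : ((cmDatum L 2 (Matrix.of fun i j : Fin 2 => if i.val + j.val + 1 = 2 then (1 : L) else 0)).Local v × (cmDatum L 1 (Matrix.of fun i j : Fin 1 => if i.val + j.val + 1 = 1 then (1 : L) else 0)).Local v)⦄,
      (∀ i j : Fin 2, Valued.v (((((γH.1.val : GL (Fin 2) (UnitaryGroup.LocalRing L v)).val.map (Pi.evalRingHom (fun w' : PlacesOver L v => w'.1.adicCompletion L) w))) - 1) i j) ≤ Valued.v (ϖ ^ 2)) → Valued.v (finGammaTwo L v γH w - 1) ≤ Valued.v (ϖ ^ 2) → IsLocalGRegular L v γH →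
      (¬ ∃ x : (w.1.adicCompletion L), ((((γH.1.val : GL (Fin 2) (UnitaryGroup.LocalRing L v)).val.map (Pi.evalRingHom (fun w' : PlacesOver L v => w'.1.adicCompletion L) w))).charpoly).IsRoot x) → ∀ ⦃n : ℕ⦄,
      Valued.v ((((γH.1.val : GL (Fin 2) (UnitaryGroup.LocalRing L v)).val.map (Pi.evalRingHom (fun w' : PlacesOver L v => w'.1.adicCompletion L) w))).trace ^ 2 - 4 * (((γH.1.val : GL (Fin 2) (UnitaryGroup.LocalRing L v)).val.map (Pi.evalRingHom (fun w' : PlacesOver L v => w'.1.adicCompletion L) w))).det) = WithZero.exp (-((2 * (2 * n + 1) : ℕ) : ℤ)) → 1 ≤ n →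
      ∀ (m : ℕ), Valued.v (((finCharpolyTwo L v γH).eval (finGammaTwo L v γH)) w) =
          Valued.v ((toPlace v w (HeckeCharacter.uniformizer ↥(maximalRealSubfield L) v : v.adicCompletion ↥(maximalRealSubfield L))) ^ m) →
        ∀ β : (v.adicCompletion ↥(maximalRealSubfield L))ˣ, toPlace v w (β : v.adicCompletion ↥(maximalRealSubfield L)) =
          -(((finCharpolyTwo L v γH).eval (finGammaTwo L v γH)) w *
              (finGammaTwo L v γH w ^ 2 +
                ((γH.1.val.val : Matrix (Fin 2) (Fin 2) (LocalRing L v)).map (Pi.evalRingHom (fun w' : PlacesOver L v => w'.1.adicCompletion L) w)).det)) /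
            (2 * finGammaTwo L v γH w ^ 2 *
              ((γH.1.val.val : Matrix (Fin 2) (Fin 2) (LocalRing L v)).map (Pi.evalRingHom (fun w' : PlacesOver L v => w'.1.adicCompletion L) w)).det) →
        ∀ (P₁ : GL (Fin 3) (w.1.adicCompletion L)) (d : Fin 2 → (w.1.adicCompletion L)) (η : (w.1.adicCompletion L)) (γ₁ : GL (Fin 2) (w.1.adicCompletion L)),
        P₁ ∈ glInt 3 (w.1.adicCompletion L) →
        formCongr (galAdicCompletionMap (L := L) (IsCMField.complexConj L) hw) P₁ (placeForm (Matrix.of fun i j : Fin 3 => if i.val + j.val + 1 = 3 then (1 : L) else 0) w.1) = !![(Matrix.diagonal d) 0 0, 0, (Matrix.diagonal d) 0 1; 0, η, 0; (Matrix.diagonal d) 1 0, 0, (Matrix.diagonal d) 1 1] →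
        (∀ i, Valued.v (d i) = 1) → (∀ i, (galAdicCompletionMap (L := L) (IsCMField.complexConj L) hw) (d i) = d i) →
        (∀ z : (w.1.adicCompletion L), Valued.v z ≤ 1 → Valued.v (d 0 + d 1 * ((galAdicCompletionMap (L := L) (IsCMField.complexConj L) hw) z * z)) = 1) →
        (∀ z : (w.1.adicCompletion L), Valued.v z ≤ 1 → Valued.v (d 0 * ((galAdicCompletionMap (L := L) (IsCMField.complexConj L) hw) z * z) + d 1) = 1) →
        (galAdicCompletionMap (L := L) (IsCMField.complexConj L) hw) η = η → Valued.v η = 1 →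
        (∀ i j, Valued.v (((γ₁ : Matrix (Fin 2) (Fin 2) (w.1.adicCompletion L)) - 1) i j) ≤ Valued.v (ϖ ^ 2)) →
        γ₁ ∈ unitaryGroupOfForm (galAdicCompletionMap (L := L) (IsCMField.complexConj L) hw) (Matrix.diagonal d) →
        (γ₁ : Matrix (Fin 2) (Fin 2) (w.1.adicCompletion L)).charpoly = (((γH.1.val : GL (Fin 2) (UnitaryGroup.LocalRing L v)).val.map (Pi.evalRingHom (fun w' : PlacesOver L v => w'.1.adicCompletion L) w))).charpoly →
        Valued.v ((γ₁ : Matrix (Fin 2) (Fin 2) (w.1.adicCompletion L)).trace ^ 2 - 4 * (γ₁ : Matrix (Fin 2) (Fin 2) (w.1.adicCompletion L)).det) = WithZero.exp (-((2 * (2 * n + 1) : ℕ) : ℤ)) →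
        (¬ ∃ x : (w.1.adicCompletion L), ((γ₁ : Matrix (Fin 2) (Fin 2) (w.1.adicCompletion L)).charpoly).IsRoot x) →
        (¬ ∃ t : (w.1.adicCompletion L), t * (galAdicCompletionMap (L := L) (IsCMField.complexConj L) hw) t = η) →
          ∀ (mA : ℕ), n = mA + 1 → m = 2 * n + 1 → ∃ (NE FP FM UP UM : ℕ),
          ((({M : Submodule (Valued.integer (w.1.adicCompletion L)) (Fin 3 → (w.1.adicCompletion L)) | IsSelfDualLattice (galAdicCompletionMap (L := L) (IsCMField.complexConj L) hw) ϖ (placeForm (Matrix.of fun i j : Fin 3 => if i.val + j.val + 1 = 3 then (1 : L) else 0) w.1) M ∧ mapGL (endoGL (((localNonsplitEquiv (IsCMField.complexConj L) (Matrix.of fun i j : Fin 2 => if i.val + j.val + 1 = 2 then (1 : L) else 0) (IsCMField.complexConj_ne_one L) w hw γH.1).val : GL (Fin 2) (w.1.adicCompletion L)), ((localNonsplitEquiv (IsCMField.complexConj L) (Matrix.of fun i j : Fin 1 => if i.val + j.val + 1 = 1 then (1 : L) else 0) (IsCMField.complexConj_ne_one L) w hw γH.2).val : GL (Fin 1) (w.1.adicCompletion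 L)))) M = M ∧ (M.map ((Matrix.toLin' (((endoGL (((localNonsplitEquiv (IsCMField.complexConj L) (Matrix.of fun i j : Fin 2 => if i.val + j.val + 1 = 2 then (1 : L) else 0) (IsCMField.complexConj_ne_one L) w hw γH.1).val : GL (Fin 2) (w.1.adicCompletion L)), ((localNonsplitEquiv (IsCMField.complexConj L) (Matrix.of fun i j : Fin 1 => if i.val + j.val + 1 = 1 then (1 : L) else 0) (IsCMField.complexConj_ne_one L) w hw γH.2).val : GL (Fin 1) (w.1.adicCompletion L))) : GL (Fin 3) (w.1.adicCompletion L)) : Matrix (Fin 3) (Fin 3) (w.1.adicCompletion L)) - 1)).restrictScalars (Valued.integer (w.1.adicCompletion L))) ≤ scaleLattice ϖ M ∧ ¬ M.map ((Matrix.toLin' (((endoGL (((localNonsplitEquiv (IsCMField.complexConj L) (Matrix.of fun i j : Fin 2 => if i.val + j.val + 1 = 2 then (1 : L) else 0) (IsCMField.complexConj_ne_one L) w hw γH.1).val : GL (Fin 2) (w.1.adicCompletion L)), ((localNonsplitEquiv (IsCMField.complexConj L) (Matrix.of fun i j : Fin 1 => if i.val + j.val + 1 = 1 then (1 : L) else 0)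 (IsCMField.complexConj_ne_one L) w hw γH.2).val : GL (Fin 1) (w.1.adicCompletion L))) : GL (Fin 3) (w.1.adicCompletion L)) : Matrix (Fin 3) (Fin 3) (w.1.adicCompletion L)) - 1)).restrictScalars (Valued.integer (w.1.adicCompletion L))) ≤ scaleLattice (ϖ ^ 2) M ∧ M.map ((Matrix.toLin' ((((endoGL (((localNonsplitEquiv (IsCMField.complexConj L) (Matrix.of fun i j : Fin 2 => if i.val + j.val + 1 = 2 then (1 : L) else 0) (IsCMField.complexConj_ne_one L) w hw γH.1).val : GL (Fin 2) (w.1.adicCompletion L)), ((localNonsplitEquiv (IsCMField.complexConj L) (Matrix.of fun i j : Fin 1 => if i.val + j.val + 1 = 1 then (1 : L) else 0) (IsCMField.complexConj_ne_one L) w hw γH.2).val : GL (Fin 1) (w.1.adicCompletion L))) : GL (Fin 3) (w.1.adicCompletion L)) : Matrix (Fin 3) (Fin 3) (w.1.adicCompletion L)) - 1) ^ 2)).restrictScalars (Valued.integer (w.1.adicCompletion L))) ≤ scaleLattice (ϖ ^ 3) M ∧ ∃ y ∈ M, ∃ a : (w.1.adicCompletion L), Valued.v a = 1 ∧ Valued.v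 (ϖ⁻¹ * pairing (galAdicCompletionMap (L := L) (IsCMField.complexConj L) hw) (placeForm (Matrix.of fun i j : Fin 3 => if i.val + j.val + 1 = 3 then (1 : L) else 0) w.1) y ((((endoGL (((localNonsplitEquiv (IsCMField.complexConj L) (Matrix.of fun i j : Fin 2 => if i.val + j.val + 1 = 2 then (1 : L) else 0) (IsCMField.complexConj_ne_one L) w hw γH.1).val : GL (Fin 2) (w.1.adicCompletion L)), ((localNonsplitEquiv (IsCMField.complexConj L) (Matrix.of fun i j : Fin 1 => if i.val + j.val + 1 = 1 then (1 : L) else 0) (IsCMField.complexConj_ne_one L) w hw γH.2).val : GL (Fin 1) (w.1.adicCompletion L))) : GL (Fin 3) (w.1.adicCompletion L)) : Matrix (Fin 3) (Fin 3) (w.1.adicCompletion L)) - 1) *ᵥ y) - c * a ^ 2) < 1)}.ncard : ℂ) =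
            (NE : ℂ) * (((Ideal.absNorm v.asIdeal : ℂ) * ((Ideal.absNorm v.asIdeal : ℂ) - 1) / 2) * (Ideal.absNorm v.asIdeal : ℂ) ^ (2 * mA) * ∑ i ∈ Finset.range mA, (Ideal.absNorm v.asIdeal : ℂ) ^ i) + (FP : ℂ) * (Ideal.absNorm v.asIdeal : ℂ) ^ (2 * mA) ∧
           ({M : Submodule (Valued.integer (w.1.adicCompletion L)) (Fin 3 → (w.1.adicCompletion L)) | IsSelfDualLattice (galAdicCompletionMap (L := L) (IsCMField.complexConj L) hw) ϖ (placeForm (Matrix.of fun i j : Fin 3 => if i.val + j.val + 1 = 3 then (1 : L) else 0) w.1) M ∧ mapGL (endoGL (((localNonsplitEquiv (IsCMField.complexConj L) (Matrix.of fun i j : Fin 2 => if i.val + j.val + 1 = 2 then (1 : L) else 0) (IsCMField.complexConj_ne_one L) w hw γH.1).val : GL (Fin 2) (w.1.adicCompletion L)), ((localNonsplitEquiv (IsCMField.complexConj L) (Matrix.of fun i j : Fin 1 => if i.val + j.val + 1 = 1 then (1 : L) else 0) (IsCMField.complexConj_ne_one L) w hw γH.2).val : GL (Fin 1) (w.1.adicCompletion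 L)))) M = M ∧ (M.map ((Matrix.toLin' (((endoGL (((localNonsplitEquiv (IsCMField.complexConj L) (Matrix.of fun i j : Fin 2 => if i.val + j.val + 1 = 2 then (1 : L) else 0) (IsCMField.complexConj_ne_one L) w hw γH.1).val : GL (Fin 2) (w.1.adicCompletion L)), ((localNonsplitEquiv (IsCMField.complexConj L) (Matrix.of fun i j : Fin 1 => if i.val + j.val + 1 = 1 then (1 : L) else 0) (IsCMField.complexConj_ne_one L) w hw γH.2).val : GL (Fin 1) (w.1.adicCompletion L))) : GL (Fin 3) (w.1.adicCompletion L)) : Matrix (Fin 3) (Fin 3) (w.1.adicCompletion L)) - 1)).restrictScalars (Valued.integer (w.1.adicCompletion L))) ≤ scaleLattice ϖ M ∧ ¬ M.map ((Matrix.toLin' (((endoGL (((localNonsplitEquiv (IsCMField.complexConj L) (Matrix.of fun i j : Fin 2 => if i.val + j.val + 1 = 2 then (1 : L) else 0) (IsCMField.complexConj_ne_one L) w hw γH.1).val : GL (Fin 2) (w.1.adicCompletion L)), ((localNonsplitEquiv (IsCMField.complexConj L) (Matrix.of fun i j : Fin 1 => if i.val + j.val + 1 = 1 then (1 : L) else 0)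 (IsCMField.complexConj_ne_one L) w hw γH.2).val : GL (Fin 1) (w.1.adicCompletion L))) : GL (Fin 3) (w.1.adicCompletion L)) : Matrix (Fin 3) (Fin 3) (w.1.adicCompletion L)) - 1)).restrictScalars (Valued.integer (w.1.adicCompletion L))) ≤ scaleLattice (ϖ ^ 2) M ∧ M.map ((Matrix.toLin' ((((endoGL (((localNonsplitEquiv (IsCMField.complexConj L) (Matrix.of fun i j : Fin 2 => if i.val + j.val + 1 = 2 then (1 : L) else 0) (IsCMField.complexConj_ne_one L) w hw γH.1).val : GL (Fin 2) (w.1.adicCompletion L)), ((localNonsplitEquiv (IsCMField.complexConj L) (Matrix.of fun i j : Fin 1 => if i.val + j.val + 1 = 1 then (1 : L) else 0) (IsCMField.complexConj_ne_one L) w hw γH.2).val : GL (Fin 1) (w.1.adicCompletion L))) : GL (Fin 3) (w.1.adicCompletion L)) : Matrix (Fin 3) (Fin 3) (w.1.adicCompletion L)) - 1) ^ 2)).restrictScalars (Valued.integer (w.1.adicCompletion L))) ≤ scaleLattice (ϖ ^ 3) M ∧ ¬ ∃ y ∈ M, ∃ a : (w.1.adicCompletion L), Valued.v a = 1 ∧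 Valued.v (ϖ⁻¹ * pairing (galAdicCompletionMap (L := L) (IsCMField.complexConj L) hw) (placeForm (Matrix.of fun i j : Fin 3 => if i.val + j.val + 1 = 3 then (1 : L) else 0) w.1) y ((((endoGL (((localNonsplitEquiv (IsCMField.complexConj L) (Matrix.of fun i j : Fin 2 => if i.val + j.val + 1 = 2 then (1 : L) else 0) (IsCMField.complexConj_ne_one L) w hw γH.1).val : GL (Fin 2) (w.1.adicCompletion L)), ((localNonsplitEquiv (IsCMField.complexConj L) (Matrix.of fun i j : Fin 1 => if i.val + j.val + 1 = 1 then (1 : L) else 0) (IsCMField.complexConj_ne_one L) w hw γH.2).val : GL (Fin 1) (w.1.adicCompletion L))) : GL (Fin 3) (w.1.adicCompletion L)) : Matrix (Fin 3) (Fin 3) (w.1.adicCompletion L)) - 1) *ᵥ y) - c * a ^ 2) < 1)}.ncard : ℂ) =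
            (NE : ℂ) * (((Ideal.absNorm v.asIdeal : ℂ) * ((Ideal.absNorm v.asIdeal : ℂ) - 1) / 2) * (Ideal.absNorm v.asIdeal : ℂ) ^ (2 * mA) * ∑ i ∈ Finset.range mA, (Ideal.absNorm v.asIdeal : ℂ) ^ i) + (FM : ℂ) * (Ideal.absNorm v.asIdeal : ℂ) ^ (2 * mA) ∧
           ({M : Submodule (Valued.integer (w.1.adicCompletion L)) (Fin 3 → (w.1.adicCompletion L)) | IsSelfDualLattice (galAdicCompletionMap (L := L) (IsCMField.complexConj L) hw) ϖ (placeForm (Matrix.of fun i j : Fin 3 => if i.val + j.val + 1 = 3 then (1 : L) else 0) w.1) M ∧ mapGL (P₁ * endoGL (γ₁, ((localNonsplitEquiv (IsCMField.complexConj L) (Matrix.of fun i j : Fin 1 => if i.val + j.val + 1 = 1 then (1 : L) else 0) (IsCMField.complexConj_ne_one L) w hw γH.2).val : GL (Fin 1) (w.1.adicCompletion L))) * P₁⁻¹) M = M ∧ (M.map ((Matrix.toLin' (((P₁ * endoGL (γ₁, ((localNonsplitEquiv (IsCMField.complexConj L) (Matrix.of fun i j : Fin 1 => if i.val + j.val +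 1 = 1 then (1 : L) else 0) (IsCMField.complexConj_ne_one L) w hw γH.2).val : GL (Fin 1) (w.1.adicCompletion L))) * P₁⁻¹ : GL (Fin 3) (w.1.adicCompletion L)) : Matrix (Fin 3) (Fin 3) (w.1.adicCompletion L)) - 1)).restrictScalars (Valued.integer (w.1.adicCompletion L))) ≤ scaleLattice ϖ M ∧ ¬ M.map ((Matrix.toLin' (((P₁ * endoGL (γ₁, ((localNonsplitEquiv (IsCMField.complexConj L) (Matrix.of fun i j : Fin 1 => if i.val + j.val + 1 = 1 then (1 : L) else 0) (IsCMField.complexConj_ne_one L) w hw γH.2).val : GL (Fin 1) (w.1.adicCompletion L))) * P₁⁻¹ : GL (Fin 3) (w.1.adicCompletion L)) : Matrix (Fin 3) (Fin 3) (w.1.adicCompletion L)) - 1)).restrictScalars (Valued.integer (w.1.adicCompletion L))) ≤ scaleLattice (ϖ ^ 2) M ∧ M.map ((Matrix.toLin' ((((P₁ * endoGL (γ₁, ((localNonsplitEquiv (IsCMField.complexConj L) (Matrix.of fun i j : Fin 1 => if i.val + j.val + 1 = 1 then (1 : L) else 0) (IsCMField.complexConj_ne_one L) w hw γH.2).val :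 GL (Fin 1) (w.1.adicCompletion L))) * P₁⁻¹ : GL (Fin 3) (w.1.adicCompletion L)) : Matrix (Fin 3) (Fin 3) (w.1.adicCompletion L)) - 1) ^ 2)).restrictScalars (Valued.integer (w.1.adicCompletion L))) ≤ scaleLattice (ϖ ^ 3) M ∧ ∃ y ∈ M, ∃ a : (w.1.adicCompletion L), Valued.v a = 1 ∧ Valued.v (ϖ⁻¹ * pairing (galAdicCompletionMap (L := L) (IsCMField.complexConj L) hw) (placeForm (Matrix.of fun i j : Fin 3 => if i.val + j.val + 1 = 3 then (1 : L) else 0) w.1) y ((((P₁ * endoGL (γ₁, ((localNonsplitEquiv (IsCMField.complexConj L) (Matrix.of fun i j : Fin 1 => if i.val + j.val + 1 = 1 then (1 : L) else 0) (IsCMField.complexConj_ne_one L) w hw γH.2).val : GL (Fin 1) (w.1.adicCompletion L))) * P₁⁻¹ : GL (Fin 3) (w.1.adicCompletion L)) : Matrix (Fin 3) (Fin 3) (w.1.adicCompletion L)) - 1) *ᵥ y) - c * a ^ 2) < 1)}.ncard : ℂ) =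
            (UP : ℂ) * (Ideal.absNorm v.asIdeal : ℂ) ^ (2 * mA) ∧
           ({M : Submodule (Valued.integer (w.1.adicCompletion L)) (Fin 3 → (w.1.adicCompletion L)) | IsSelfDualLattice (galAdicCompletionMap (L := L) (IsCMField.complexConj L) hw) ϖ (placeForm (Matrix.of fun i j : Fin 3 => if i.val + j.val + 1 = 3 then (1 : L) else 0) w.1) M ∧ mapGL (P₁ * endoGL (γ₁, ((localNonsplitEquiv (IsCMField.complexConj L) (Matrix.of fun i j : Fin 1 => if i.val + j.val + 1 = 1 then (1 : L) else 0) (IsCMField.complexConj_ne_one L) w hw γH.2).val : GL (Fin 1) (w.1.adicCompletion L))) * P₁⁻¹) M = M ∧ (M.map ((Matrix.toLin' (((P₁ * endoGL (γ₁, ((localNonsplitEquiv (IsCMField.complexConj L) (Matrix.of fun i j : Fin 1 => if i.val + j.val + 1 = 1 then (1 : L) else 0) (IsCMField.complexConj_ne_one L) w hw γH.2).val : GL (Fin 1) (w.1.adicCompletion L))) * P₁⁻¹ : GL (Fin 3) (w.1.adicCompletion L)) : Matrix (Fin 3) (Fin 3) (w.1.adicCompletion L)) - 1)).restrictScalars (Valued.integer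 (w.1.adicCompletion L))) ≤ scaleLattice ϖ M ∧ ¬ M.map ((Matrix.toLin' (((P₁ * endoGL (γ₁, ((localNonsplitEquiv (IsCMField.complexConj L) (Matrix.of fun i j : Fin 1 => if i.val + j.val + 1 = 1 then (1 : L) else 0) (IsCMField.complexConj_ne_one L) w hw γH.2).val : GL (Fin 1) (w.1.adicCompletion L))) * P₁⁻¹ : GL (Fin 3) (w.1.adicCompletion L)) : Matrix (Fin 3) (Fin 3) (w.1.adicCompletion L)) - 1)).restrictScalars (Valued.integer (w.1.adicCompletion L))) ≤ scaleLattice (ϖ ^ 2) M ∧ M.map ((Matrix.toLin' ((((P₁ * endoGL (γ₁, ((localNonsplitEquiv (IsCMField.complexConj L) (Matrix.of fun i j : Fin 1 => if i.val + j.val + 1 = 1 then (1 : L) else 0) (IsCMField.complexConj_ne_one L) w hw γH.2).val : GL (Fin 1) (w.1.adicCompletion L))) * P₁⁻¹ : GL (Fin 3) (w.1.adicCompletion L)) : Matrix (Fin 3) (Fin 3) (w.1.adicCompletion L)) - 1) ^ 2)).restrictScalars (Valued.integer (w.1.adicCompletion L))) ≤ scaleLattice (ϖ ^ 3) M ∧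 ¬ ∃ y ∈ M, ∃ a : (w.1.adicCompletion L), Valued.v a = 1 ∧ Valued.v (ϖ⁻¹ * pairing (galAdicCompletionMap (L := L) (IsCMField.complexConj L) hw) (placeForm (Matrix.of fun i j : Fin 3 => if i.val + j.val + 1 = 3 then (1 : L) else 0) w.1) y ((((P₁ * endoGL (γ₁, ((localNonsplitEquiv (IsCMField.complexConj L) (Matrix.of fun i j : Fin 1 => if i.val + j.val + 1 = 1 then (1 : L) else 0) (IsCMField.complexConj_ne_one L) w hw γH.2).val : GL (Fin 1) (w.1.adicCompletion L))) * P₁⁻¹ : GL (Fin 3) (w.1.adicCompletion L)) : Matrix (Fin 3) (Fin 3) (w.1.adicCompletion L)) - 1) *ᵥ y) - c * a ^ 2) < 1)}.ncard : ℂ) =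
            (UM : ℂ) * (Ideal.absNorm v.asIdeal : ℂ) ^ (2 * mA) ∧ hilbertSymbol (v.adicCompletion ↥(maximalRealSubfield L)) (β : v.adicCompletion ↥(maximalRealSubfield L)) (algebraMap ↥(maximalRealSubfield L) _ ((cmQuadraticGenerator L : 𝓞 ↥(maximalRealSubfield L)) : ↥(maximalRealSubfield L))) = 1) ∨
          (({M : Submodule (Valued.integer (w.1.adicCompletion L)) (Fin 3 → (w.1.adicCompletion L)) | IsSelfDualLattice (galAdicCompletionMap (L := L) (IsCMField.complexConj L) hw) ϖ (placeForm (Matrix.of fun i j : Fin 3 => if i.val + j.val + 1 = 3 then (1 : L) else 0) w.1) M ∧ mapGL (endoGL (((localNonsplitEquiv (IsCMField.complexConj L) (Matrix.of fun i j : Fin 2 => if i.val + j.val + 1 = 2 then (1 : L) else 0) (IsCMField.complexConj_ne_one L) w hw γH.1).val : GL (Fin 2) (w.1.adicCompletion L)), ((localNonsplitEquiv (IsCMField.complexConj L) (Matrix.of fun i j : Fin 1 => if i.val + j.val + 1 = 1 then (1 : L) else 0) (IsCMField.complexConj_ne_one L) w hw γH.2).val : GL (Fin 1) (w.1.adicCompletion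 L)))) M = M ∧ (M.map ((Matrix.toLin' (((endoGL (((localNonsplitEquiv (IsCMField.complexConj L) (Matrix.of fun i j : Fin 2 => if i.val + j.val + 1 = 2 then (1 : L) else 0) (IsCMField.complexConj_ne_one L) w hw γH.1).val : GL (Fin 2) (w.1.adicCompletion L)), ((localNonsplitEquiv (IsCMField.complexConj L) (Matrix.of fun i j : Fin 1 => if i.val + j.val + 1 = 1 then (1 : L) else 0) (IsCMField.complexConj_ne_one L) w hw γH.2).val : GL (Fin 1) (w.1.adicCompletion L))) : GL (Fin 3) (w.1.adicCompletion L)) : Matrix (Fin 3) (Fin 3) (w.1.adicCompletion L)) - 1)).restrictScalars (Valued.integer (w.1.adicCompletion L))) ≤ scaleLattice ϖ M ∧ ¬ M.map ((Matrix.toLin' (((endoGL (((localNonsplitEquiv (IsCMField.complexConj L) (Matrix.of fun i j : Fin 2 => if i.val + j.val + 1 = 2 then (1 : L) else 0) (IsCMField.complexConj_ne_one L) w hw γH.1).val : GL (Fin 2) (w.1.adicCompletion L)), ((localNonsplitEquiv (IsCMField.complexConj L) (Matrix.of fun i j : Fin 1 => if i.val + j.val + 1 = 1 then (1 : L) else 0)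 (IsCMField.complexConj_ne_one L) w hw γH.2).val : GL (Fin 1) (w.1.adicCompletion L))) : GL (Fin 3) (w.1.adicCompletion L)) : Matrix (Fin 3) (Fin 3) (w.1.adicCompletion L)) - 1)).restrictScalars (Valued.integer (w.1.adicCompletion L))) ≤ scaleLattice (ϖ ^ 2) M ∧ M.map ((Matrix.toLin' ((((endoGL (((localNonsplitEquiv (IsCMField.complexConj L) (Matrix.of fun i j : Fin 2 => if i.val + j.val + 1 = 2 then (1 : L) else 0) (IsCMField.complexConj_ne_one L) w hw γH.1).val : GL (Fin 2) (w.1.adicCompletion L)), ((localNonsplitEquiv (IsCMField.complexConj L) (Matrix.of fun i j : Fin 1 => if i.val + j.val + 1 = 1 then (1 : L) else 0) (IsCMField.complexConj_ne_one L) w hw γH.2).val : GL (Fin 1) (w.1.adicCompletion L))) : GL (Fin 3) (w.1.adicCompletion L)) : Matrix (Fin 3) (Fin 3) (w.1.adicCompletion L)) - 1) ^ 2)).restrictScalars (Valued.integer (w.1.adicCompletion L))) ≤ scaleLattice (ϖ ^ 3) M ∧ ∃ y ∈ M, ∃ a : (w.1.adicCompletion L), Valued.v a = 1 ∧ Valued.v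 (ϖ⁻¹ * pairing (galAdicCompletionMap (L := L) (IsCMField.complexConj L) hw) (placeForm (Matrix.of fun i j : Fin 3 => if i.val + j.val + 1 = 3 then (1 : L) else 0) w.1) y ((((endoGL (((localNonsplitEquiv (IsCMField.complexConj L) (Matrix.of fun i j : Fin 2 => if i.val + j.val + 1 = 2 then (1 : L) else 0) (IsCMField.complexConj_ne_one L) w hw γH.1).val : GL (Fin 2) (w.1.adicCompletion L)), ((localNonsplitEquiv (IsCMField.complexConj L) (Matrix.of fun i j : Fin 1 => if i.val + j.val + 1 = 1 then (1 : L) else 0) (IsCMField.complexConj_ne_one L) w hw γH.2).val : GL (Fin 1) (w.1.adicCompletion L))) : GL (Fin 3) (w.1.adicCompletion L)) : Matrix (Fin 3) (Fin 3) (w.1.adicCompletion L)) - 1) *ᵥ y) - c * a ^ 2) < 1)}.ncard : ℂ) =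
            (UP : ℂ) * (Ideal.absNorm v.asIdeal : ℂ) ^ (2 * mA) ∧
           ({M : Submodule (Valued.integer (w.1.adicCompletion L)) (Fin 3 → (w.1.adicCompletion L)) | IsSelfDualLattice (galAdicCompletionMap (L := L) (IsCMField.complexConj L) hw) ϖ (placeForm (Matrix.of fun i j : Fin 3 => if i.val + j.val + 1 = 3 then (1 : L) else 0) w.1) M ∧ mapGL (endoGL (((localNonsplitEquiv (IsCMField.complexConj L) (Matrix.of fun i j : Fin 2 => if i.val + j.val + 1 = 2 then (1 : L) else 0) (IsCMField.complexConj_ne_one L) w hw γH.1).val : GL (Fin 2) (w.1.adicCompletion L)), ((localNonsplitEquiv (IsCMField.complexConj L) (Matrix.of fun i j : Fin 1 => if i.val + j.val + 1 = 1 then (1 : L) else 0) (IsCMField.complexConj_ne_one L) w hw γH.2).val : GL (Fin 1) (w.1.adicCompletion L)))) M = M ∧ (M.map ((Matrix.toLin' (((endoGL (((localNonsplitEquiv (IsCMField.complexConj L) (Matrix.of fun i j : Fin 2 => if i.val + j.val + 1 = 2 then (1 : L) else 0) (IsCMField.complexConj_ne_one L) w hw γH.1).val : GL (Fin 2) (w.1.adicCompletion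 L)), ((localNonsplitEquiv (IsCMField.complexConj L) (Matrix.of fun i j : Fin 1 => if i.val + j.val + 1 = 1 then (1 : L) else 0) (IsCMField.complexConj_ne_one L) w hw γH.2).val : GL (Fin 1) (w.1.adicCompletion L))) : GL (Fin 3) (w.1.adicCompletion L)) : Matrix (Fin 3) (Fin 3) (w.1.adicCompletion L)) - 1)).restrictScalars (Valued.integer (w.1.adicCompletion L))) ≤ scaleLattice ϖ M ∧ ¬ M.map ((Matrix.toLin' (((endoGL (((localNonsplitEquiv (IsCMField.complexConj L) (Matrix.of fun i j : Fin 2 => if i.val + j.val + 1 = 2 then (1 : L) else 0) (IsCMField.complexConj_ne_one L) w hw γH.1).val : GL (Fin 2) (w.1.adicCompletion L)), ((localNonsplitEquiv (IsCMField.complexConj L) (Matrix.of fun i j : Fin 1 => if i.val + j.val + 1 = 1 then (1 : L) else 0) (IsCMField.complexConj_ne_one L) w hw γH.2).val : GL (Fin 1) (w.1.adicCompletion L))) : GL (Fin 3) (w.1.adicCompletion L)) : Matrix (Fin 3) (Fin 3) (w.1.adicCompletion L)) - 1)).restrictScalars (Valued.integer (w.1.adicCompletion L))) ≤ scaleLattice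 (ϖ ^ 2) M ∧ M.map ((Matrix.toLin' ((((endoGL (((localNonsplitEquiv (IsCMField.complexConj L) (Matrix.of fun i j : Fin 2 => if i.val + j.val + 1 = 2 then (1 : L) else 0) (IsCMField.complexConj_ne_one L) w hw γH.1).val : GL (Fin 2) (w.1.adicCompletion L)), ((localNonsplitEquiv (IsCMField.complexConj L) (Matrix.of fun i j : Fin 1 => if i.val + j.val + 1 = 1 then (1 : L) else 0) (IsCMField.complexConj_ne_one L) w hw γH.2).val : GL (Fin 1) (w.1.adicCompletion L))) : GL (Fin 3) (w.1.adicCompletion L)) : Matrix (Fin 3) (Fin 3) (w.1.adicCompletion L)) - 1) ^ 2)).restrictScalars (Valued.integer (w.1.adicCompletion L))) ≤ scaleLattice (ϖ ^ 3) M ∧ ¬ ∃ y ∈ M, ∃ a : (w.1.adicCompletion L), Valued.v a = 1 ∧ Valued.v (ϖ⁻¹ * pairing (galAdicCompletionMap (L := L) (IsCMField.complexConj L) hw) (placeForm (Matrix.of fun i j : Fin 3 => if i.val + j.val + 1 = 3 then (1 : L) else 0) w.1) y ((((endoGL (((localNonsplitEquiv (IsCMField.complexConj L) (Matrix.of fun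 i j : Fin 2 => if i.val + j.val + 1 = 2 then (1 : L) else 0) (IsCMField.complexConj_ne_one L) w hw γH.1).val : GL (Fin 2) (w.1.adicCompletion L)), ((localNonsplitEquiv (IsCMField.complexConj L) (Matrix.of fun i j : Fin 1 => if i.val + j.val + 1 = 1 then (1 : L) else 0) (IsCMField.complexConj_ne_one L) w hw γH.2).val : GL (Fin 1) (w.1.adicCompletion L))) : GL (Fin 3) (w.1.adicCompletion L)) : Matrix (Fin 3) (Fin 3) (w.1.adicCompletion L)) - 1) *ᵥ y) - c * a ^ 2) < 1)}.ncard : ℂ) =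
            (UM : ℂ) * (Ideal.absNorm v.asIdeal : ℂ) ^ (2 * mA) ∧
           ({M : Submodule (Valued.integer (w.1.adicCompletion L)) (Fin 3 → (w.1.adicCompletion L)) | IsSelfDualLattice (galAdicCompletionMap (L := L) (IsCMField.complexConj L) hw) ϖ (placeForm (Matrix.of fun i j : Fin 3 => if i.val + j.val + 1 = 3 then (1 : L) else 0) w.1) M ∧ mapGL (P₁ * endoGL (γ₁, ((localNonsplitEquiv (IsCMField.complexConj L) (Matrix.of fun i j : Fin 1 => if i.val + j.val + 1 = 1 then (1 : L) else 0) (IsCMField.complexConj_ne_one L) w hw γH.2).val : GL (Fin 1) (w.1.adicCompletion L))) * P₁⁻¹) M = M ∧ (M.map ((Matrix.toLin' (((P₁ * endoGL (γ₁, ((localNonsplitEquiv (IsCMField.complexConj L) (Matrix.of fun i j : Fin 1 => if i.val + j.val + 1 = 1 then (1 : L) else 0) (IsCMField.complexConj_ne_one L) w hw γH.2).val : GL (Fin 1) (w.1.adicCompletion L))) * P₁⁻¹ : GL (Fin 3) (w.1.adicCompletion L)) : Matrix (Fin 3) (Fin 3) (w.1.adicCompletion L)) - 1)).restrictScalars (Valued.integer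 (w.1.adicCompletion L))) ≤ scaleLattice ϖ M ∧ ¬ M.map ((Matrix.toLin' (((P₁ * endoGL (γ₁, ((localNonsplitEquiv (IsCMField.complexConj L) (Matrix.of fun i j : Fin 1 => if i.val + j.val + 1 = 1 then (1 : L) else 0) (IsCMField.complexConj_ne_one L) w hw γH.2).val : GL (Fin 1) (w.1.adicCompletion L))) * P₁⁻¹ : GL (Fin 3) (w.1.adicCompletion L)) : Matrix (Fin 3) (Fin 3) (w.1.adicCompletion L)) - 1)).restrictScalars (Valued.integer (w.1.adicCompletion L))) ≤ scaleLattice (ϖ ^ 2) M ∧ M.map ((Matrix.toLin' ((((P₁ * endoGL (γ₁, ((localNonsplitEquiv (IsCMField.complexConj L) (Matrix.of fun i j : Fin 1 => if i.val + j.val + 1 = 1 then (1 : L) else 0) (IsCMField.complexConj_ne_one L) w hw γH.2).val : GL (Fin 1) (w.1.adicCompletion L))) * P₁⁻¹ : GL (Fin 3) (w.1.adicCompletion L)) : Matrix (Fin 3) (Fin 3) (w.1.adicCompletion L)) - 1) ^ 2)).restrictScalars (Valued.integer (w.1.adicCompletion L))) ≤ scaleLattice (ϖ ^ 3) M ∧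 ∃ y ∈ M, ∃ a : (w.1.adicCompletion L), Valued.v a = 1 ∧ Valued.v (ϖ⁻¹ * pairing (galAdicCompletionMap (L := L) (IsCMField.complexConj L) hw) (placeForm (Matrix.of fun i j : Fin 3 => if i.val + j.val + 1 = 3 then (1 : L) else 0) w.1) y ((((P₁ * endoGL (γ₁, ((localNonsplitEquiv (IsCMField.complexConj L) (Matrix.of fun i j : Fin 1 => if i.val + j.val + 1 = 1 then (1 : L) else 0) (IsCMField.complexConj_ne_one L) w hw γH.2).val : GL (Fin 1) (w.1.adicCompletion L))) * P₁⁻¹ : GL (Fin 3) (w.1.adicCompletion L)) : Matrix (Fin 3) (Fin 3) (w.1.adicCompletion L)) - 1) *ᵥ y) - c * a ^ 2) < 1)}.ncard : ℂ) =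
            (NE : ℂ) * (((Ideal.absNorm v.asIdeal : ℂ) * ((Ideal.absNorm v.asIdeal : ℂ) - 1) / 2) * (Ideal.absNorm v.asIdeal : ℂ) ^ (2 * mA) * ∑ i ∈ Finset.range mA, (Ideal.absNorm v.asIdeal : ℂ) ^ i) + (FP : ℂ) * (Ideal.absNorm v.asIdeal : ℂ) ^ (2 * mA) ∧
           ({M : Submodule (Valued.integer (w.1.adicCompletion L)) (Fin 3 → (w.1.adicCompletion L)) | IsSelfDualLattice (galAdicCompletionMap (L := L) (IsCMField.complexConj L) hw) ϖ (placeForm (Matrix.of fun i j : Fin 3 => if i.val + j.val + 1 = 3 then (1 : L) else 0) w.1) M ∧ mapGL (P₁ * endoGL (γ₁, ((localNonsplitEquiv (IsCMField.complexConj L) (Matrix.of fun i j : Fin 1 => if i.val + j.val + 1 = 1 then (1 : L) else 0) (IsCMField.complexConj_ne_one L) w hw γH.2).val : GL (Fin 1) (w.1.adicCompletion L))) * P₁⁻¹) M = M ∧ (M.map ((Matrix.toLin' (((P₁ * endoGL (γ₁, ((localNonsplitEquiv (IsCMField.complexConj L) (Matrix.of fun i j : Fin 1 => if i.val + j.val +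 1 = 1 then (1 : L) else 0) (IsCMField.complexConj_ne_one L) w hw γH.2).val : GL (Fin 1) (w.1.adicCompletion L))) * P₁⁻¹ : GL (Fin 3) (w.1.adicCompletion L)) : Matrix (Fin 3) (Fin 3) (w.1.adicCompletion L)) - 1)).restrictScalars (Valued.integer (w.1.adicCompletion L))) ≤ scaleLattice ϖ M ∧ ¬ M.map ((Matrix.toLin' (((P₁ * endoGL (γ₁, ((localNonsplitEquiv (IsCMField.complexConj L) (Matrix.of fun i j : Fin 1 => if i.val + j.val + 1 = 1 then (1 : L) else 0) (IsCMField.complexConj_ne_one L) w hw γH.2).val : GL (Fin 1) (w.1.adicCompletion L))) * P₁⁻¹ : GL (Fin 3) (w.1.adicCompletion L)) : Matrix (Fin 3) (Fin 3) (w.1.adicCompletion L)) - 1)).restrictScalars (Valued.integer (w.1.adicCompletion L))) ≤ scaleLattice (ϖ ^ 2) M ∧ M.map ((Matrix.toLin' ((((P₁ * endoGL (γ₁, ((localNonsplitEquiv (IsCMField.complexConj L) (Matrix.of fun i j : Fin 1 => if i.val + j.val + 1 = 1 then (1 : L) else 0) (IsCMField.complexConj_ne_one L) w hw γH.2).val :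 GL (Fin 1) (w.1.adicCompletion L))) * P₁⁻¹ : GL (Fin 3) (w.1.adicCompletion L)) : Matrix (Fin 3) (Fin 3) (w.1.adicCompletion L)) - 1) ^ 2)).restrictScalars (Valued.integer (w.1.adicCompletion L))) ≤ scaleLattice (ϖ ^ 3) M ∧ ¬ ∃ y ∈ M, ∃ a : (w.1.adicCompletion L), Valued.v a = 1 ∧ Valued.v (ϖ⁻¹ * pairing (galAdicCompletionMap (L := L) (IsCMField.complexConj L) hw) (placeForm (Matrix.of fun i j : Fin 3 => if i.val + j.val + 1 = 3 then (1 : L) else 0) w.1) y ((((P₁ * endoGL (γ₁, ((localNonsplitEquiv (IsCMField.complexConj L) (Matrix.of fun i j : Fin 1 => if i.val + j.val + 1 = 1 then (1 : L) else 0) (IsCMField.complexConj_ne_one L) w hw γH.2).val : GL (Fin 1) (w.1.adicCompletion L))) * P₁⁻¹ : GL (Fin 3) (w.1.adicCompletion L)) : Matrix (Fin 3) (Fin 3) (w.1.adicCompletion L)) - 1) *ᵥ y) - c * a ^ 2) < 1)}.ncard : ℂ) =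
            (NE : ℂ) * (((Ideal.absNorm v.asIdeal : ℂ) * ((Ideal.absNorm v.asIdeal : ℂ) - 1) / 2) * (Ideal.absNorm v.asIdeal : ℂ) ^ (2 * mA) * ∑ i ∈ Finset.range mA, (Ideal.absNorm v.asIdeal : ℂ) ^ i) + (FM : ℂ) * (Ideal.absNorm v.asIdeal : ℂ) ^ (2 * mA) ∧ hilbertSymbol (v.adicCompletion ↥(maximalRealSubfield L)) (β : v.adicCompletion ↥(maximalRealSubfield L)) (algebraMap ↥(maximalRealSubfield L) _ ((cmQuadraticGenerator L : 𝓞 ↥(maximalRealSubfield L)) : ↥(maximalRealSubfield L))) = -1)) ∧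
          (NE : ℂ) = 2 * (Ideal.absNorm v.asIdeal : ℂ) ∧ (UP : ℂ) - (FP : ℂ) = (Ideal.absNorm v.asIdeal : ℂ) ∧ (UM : ℂ) - (FM : ℂ) = (Ideal.absNorm v.asIdeal : ℂ) := by
  intro c hcle hcred γH hblk hu2 _hreg hirr n hdisc hn m hm β hβ P₁ d η γ₁ hP₁ hform hdv hσd han₀ han₁ hση hηv hγ2 hγU hχ hdiscγ hirrγ hηN mA hnA hmN
  classical
  have hmA : m = 2 * mA + 3 := by omega
  -- THE CM DRESS (★ p849618 ∕ ★ p849443 pattern)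
  have hc1 : IsCMField.complexConj L ≠ 1 := IsCMField.complexConj_ne_one L
  have h2v : Valued.v (2 : (w.1.adicCompletion L)) = 1 := (isUnit_two_integer_iff_valued_eq_one L w.1).1 h2
  have hσσ : ∀ z : (w.1.adicCompletion L), (galAdicCompletionMap (L := L) (IsCMField.complexConj L) hw) ((galAdicCompletionMap (L := L) (IsCMField.complexConj L) hw) z) = z :=
    galAdicCompletionMap_galAdicCompletionMap_of_smul_eq (IsCMField.complexConj L) w hc1 hw
  have hvσ : ∀ z : (w.1.adicCompletion L), Valued.v ((galAdicCompletionMap (L := L) (IsCMField.complexConj L) hw) z) = Valued.v z := fun z =>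
    valued_galAdicCompletionMap (L := L) (IsCMField.complexConj L) hw z
  have Tram := ramifiedBlock_adicCompletion L v w hw he h2v
  obtain ⟨-, -, -, hres, hnorm⟩ := Tram
  haveI : Fintype (Valued.ResidueField (w.1.adicCompletion L)) := Fintype.ofFinite _
  haveI := isPrincipalIdealRing_integer_adicCompletion L v w
  have hqN : (Nat.card (Valued.ResidueField (w.1.adicCompletion L)) : ℂ) = (Ideal.absNorm v.asIdeal : ℂ) := by
    congr 1
    rw [← natCard_residueField_eq_of_compatible, natCard_residueField_eq_of_ramified (IsCMField.complexConj L) v hc1 w hw he, Ideal.absNorm_apply, Submodule.cardQuot_apply]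
  have hk2 : ringChar (Valued.ResidueField (w.1.adicCompletion L)) ≠ 2 := ringChar_residueField_ne_two h2v
  have hϖ0 : ϖ ≠ 0 := fun h0 => by rw [h0, Valuation.map_zero] at hϖ; exact WithZero.exp_ne_zero hϖ.symm
  -- the class constant is a unit
  have hc : Valued.v c = 1 := (v_eq_one_iff_valuation_eq_one c).2 ((red_ne_zero_iff_valuation_eq_one c).1 (left_ne_zero_of_mul_eq_one hcred))
  let c₀ : Valued.integer (w.1.adicCompletion L) := ⟨c, hcle⟩
  have hc₀ : ((c₀ : Valued.integer (w.1.adicCompletion L)) : (w.1.adicCompletion L)) = c := rfl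
  have hc₀' : (IsLocalRing.residue (Valued.integer (w.1.adicCompletion L)) (-c₀))⁻¹ ≠ 0 := by
    refine inv_ne_zero (residue_ne_zero_of_v_eq_one _ ?_)
    rw [NegMemClass.coe_neg, Valuation.map_neg, hc₀, hc]
  -- the non-square token `η` (★ p849189 §1)
  have hηε := valued_sq_sub_eq_one_of_not_exists_norm hσσ hvσ hres hnorm hση hηv hηN
  -- THE HYPERBOLIC ROOT: the centring unit `s` (`s·û₀₀ = 1`), the W-centre `k`, `γh = ι(B₀, 1)`, `B₀ = k⁻¹(s ĝ)k`
  have Ts := exists_units_mul_oneByOne_eq_one (((localNonsplitEquiv (IsCMField.complexConj L) (Matrix.of fun i j : Fin 1 => if i.val + j.val + 1 = 1 then (1 : L) else 0) (IsCMField.complexConj_ne_one L) w hw γH.2).val : GL (Fin 1) (w.1.adicCompletion L)))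
  obtain ⟨s, hs⟩ := Ts
  have hsu : (s : (w.1.adicCompletion L)) * finGammaTwo L v γH w = 1 := hs
  have Tk := exists_centre_forall_v_rerootedCentred_sub_one_le_of_odd_ram L w hw he h2 ϖ hϖ hσϖ γH hblk hu2 hirr hdisc m hm β hβ s hs
  obtain ⟨k, hk, hd⟩ := Tk
  let γh : unitaryGroupOfForm (galAdicCompletionMap (L := L) (IsCMField.complexConj L) hw) ((StdForm.antidiagonal 3).over (w.1.adicCompletion L)) :=
    ⟨endoGL ((k⁻¹ * (Matrix.GeneralLinearGroup.scalar (Fin 2) s * ((localNonsplitEquiv (IsCMField.complexConj L) (Matrix.of fun i j : Fin 2 => if i.val + j.val + 1 = 2 then (1 : L) else 0) (IsCMField.complexConj_ne_one L) w hw γH.1).val : GL (Fin 2) (w.1.adicCompletion L))) * k : GL (Fin 2) (w.1.adicCompletion L)), (1 : GL (Fin 1) (w.1.adicCompletion L))), endoGL_rerootedCentred_mem_unitaryGroupOfForm_ram L w hw γH s hs k hk⟩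
  have hγh : (γh : GL (Fin 3) (w.1.adicCompletion L)) = endoGL ((k⁻¹ * (Matrix.GeneralLinearGroup.scalar (Fin 2) s * ((localNonsplitEquiv (IsCMField.complexConj L) (Matrix.of fun i j : Fin 2 => if i.val + j.val + 1 = 2 then (1 : L) else 0) (IsCMField.complexConj_ne_one L) w hw γH.1).val : GL (Fin 2) (w.1.adicCompletion L))) * k : GL (Fin 2) (w.1.adicCompletion L)), (1 : GL (Fin 1) (w.1.adicCompletion L))) := rfl
  -- ★ p849618 (F0P3a-p01 (g18)): THE HYPERBOLIC ROOT CENSUS IN PARAMS CURRENCY; ★ p849335 (F0P3a-p08): the socket totals `#hyp±(c)`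
  have TYh :=
    BlockLawHyp.hyperbolicRootCensus_params_odd_ram L w hw he h2 ϖ hϖ hσϖ γH hblk hu2 hirr hdisc hn m hm β hβ hmN s hs k hk hd γh hγh c c₀ hc₀ hc
  obtain ⟨Yh, hYh, hdiagh, hirrh, hHSh, hsRh, hNEh, hNPh, hNMh⟩ := TYh
  have Hh := BlockLawHyp.hyperbolicTotal_pm_ram_of_region_census_odd L w hw he h2 ϖ hϖ hσϖ γH hu2 hirr m mA hmA s hs k hk hd γh hγh c η hc hηv hηε _ hsRh _ _ _ hNEh hNPh hNMh
  -- the hyperbolic scalars (★ p849534, F0P3a-p02 (g18), ι-shape adapter)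
  have hdiagh' : (!![IsLocalRing.residue (Valued.integer (w.1.adicCompletion L)) (Yh 0 0), 0, IsLocalRing.residue (Valued.integer (w.1.adicCompletion L)) (Yh 0 1); 0, 0, 0; IsLocalRing.residue (Valued.integer (w.1.adicCompletion L)) (Yh 1 0), 0, IsLocalRing.residue (Valued.integer (w.1.adicCompletion L)) (Yh 1 1)] : Matrix (Fin 3) (Fin 3) (Valued.ResidueField (w.1.adicCompletion L))) 2 2 = (!![IsLocalRing.residue (Valued.integer (w.1.adicCompletion L)) (Yh 0 0), 0, IsLocalRing.residue (Valued.integer (w.1.adicCompletion L)) (Yh 0 1); 0, 0, 0; IsLocalRing.residue (Valued.integer (w.1.adicCompletion L)) (Yh 1 0), 0, IsLocalRing.residue (Valued.integer (w.1.adicCompletion L)) (Yh 1 1)] : Matrix (Fin 3) (Fin 3) (Valued.ResidueField (w.1.adicCompletion L))) 0 0 := by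
    simp only [Matrix.of_apply, Matrix.cons_val', Matrix.cons_val_zero, Matrix.cons_val_two, Matrix.empty_val', Matrix.cons_val_fin_one, Matrix.tail_cons, Matrix.head_cons, Matrix.head_fin_const]
    exact hdiagh.symm
  have hirrh' : quadraticChar (Valued.ResidueField (w.1.adicCompletion L)) ((!![IsLocalRing.residue (Valued.integer (w.1.adicCompletion L)) (Yh 0 0), 0, IsLocalRing.residue (Valued.integer (w.1.adicCompletion L)) (Yh 0 1); 0, 0, 0; IsLocalRing.residue (Valued.integer (w.1.adicCompletion L)) (Yh 1 0), 0, IsLocalRing.residue (Valued.integer (w.1.adicCompletion L)) (Yh 1 1)] : Matrix (Fin 3) (Fin 3) (Valued.ResidueField (w.1.adicCompletion L))) 0 2 * (!![IsLocalRing.residue (Valued.integer (w.1.adicCompletion L)) (Yh 0 0), 0, IsLocalRing.residue (Valued.integer (w.1.adicCompletion L)) (Yh 0 1); 0, 0, 0; IsLocalRing.residue (Valued.integer (w.1.adicCompletion L)) (Yh 1 0), 0, IsLocalRing.residue (Valued.integer (w.1.adicCompletion L)) (Yh 1 1)] : Matrix (Fin 3) (Fin 3) (Valued.ResidueField (w.1.adicCompletion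 L))) 2 0) = -1 := by
    simp only [Matrix.of_apply, Matrix.cons_val', Matrix.cons_val_zero, Matrix.cons_val_two, Matrix.empty_val', Matrix.cons_val_fin_one, Matrix.tail_cons, Matrix.head_cons, Matrix.head_fin_const]
    exact hirrh
  have nh := natCard_params_iotaShape_null_eq hk2 (!![IsLocalRing.residue (Valued.integer (w.1.adicCompletion L)) (Yh 0 0), 0, IsLocalRing.residue (Valued.integer (w.1.adicCompletion L)) (Yh 0 1); 0, 0, 0; IsLocalRing.residue (Valued.integer (w.1.adicCompletion L)) (Yh 1 0), 0, IsLocalRing.residue (Valued.integer (w.1.adicCompletion L)) (Yh 1 1)] : Matrix (Fin 3) (Fin 3) (Valued.ResidueField (w.1.adicCompletion L))) rfl rfl rfl rfl rfl hdiagh' hirrh'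
  have ch : ∀ ε : ℤ, ε = 1 ∨ ε = -1 → 2 * ((Nat.card {p : Option {p : Valued.ResidueField (w.1.adicCompletion L) × Valued.ResidueField (w.1.adicCompletion L) // p.2 + (RingHom.id (Valued.ResidueField (w.1.adicCompletion L))) p.2 + p.1 * (RingHom.id (Valued.ResidueField (w.1.adicCompletion L))) p.1 = 0} // quadraticChar (Valued.ResidueField (w.1.adicCompletion L)) ((IsLocalRing.residue (Valued.integer (w.1.adicCompletion L)) (-c₀))⁻¹ * ((p.elim (Pi.single 2 1) fun q => ![(1 : Valued.ResidueField (w.1.adicCompletion L)), q.1.1, q.1.2]) ⬝ᵥ ((((((StdForm.antidiagonal 3).over (Valued.ResidueField (w.1.adicCompletion L)))) * (!![IsLocalRing.residue (Valued.integer (w.1.adicCompletion L)) (Yh 0 0), 0, IsLocalRing.residue (Valued.integer (w.1.adicCompletion L)) (Yh 0 1); 0, 0, 0; IsLocalRing.residue (Valued.integer (w.1.adicCompletion L)) (Yh 1 0), 0, IsLocalRing.residue (Valued.integer (w.1.adicCompletion L)) (Yh 1 1)] : Matrix (Fin 3) (Fin 3) (Valued.ResidueField (w.1.adicCompletion L))))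 *ᵥ (p.elim (Pi.single 2 1) fun q => ![(1 : Valued.ResidueField (w.1.adicCompletion L)), q.1.1, q.1.2]))))) = ε} : ℕ) : ℤ) =
      Fintype.card (Valued.ResidueField (w.1.adicCompletion L)) - quadraticChar (Valued.ResidueField (w.1.adicCompletion L)) ((!![IsLocalRing.residue (Valued.integer (w.1.adicCompletion L)) (Yh 0 0), 0, IsLocalRing.residue (Valued.integer (w.1.adicCompletion L)) (Yh 0 1); 0, 0, 0; IsLocalRing.residue (Valued.integer (w.1.adicCompletion L)) (Yh 1 0), 0, IsLocalRing.residue (Valued.integer (w.1.adicCompletion L)) (Yh 1 1)] : Matrix (Fin 3) (Fin 3) (Valued.ResidueField (w.1.adicCompletion L))) 0 0 ^ 2 - (!![IsLocalRing.residue (Valued.integer (w.1.adicCompletion L)) (Yh 0 0), 0, IsLocalRing.residue (Valued.integer (w.1.adicCompletion L)) (Yh 0 1); 0, 0, 0; IsLocalRing.residue (Valued.integer (w.1.adicCompletion L)) (Yh 1 0), 0, IsLocalRing.residue (Valued.integer (w.1.adicCompletion L)) (Yh 1 1)] : Matrix (Fin 3) (Fin 3) (Valued.ResidueField (w.1.adicCompletion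 L))) 0 2 * (!![IsLocalRing.residue (Valued.integer (w.1.adicCompletion L)) (Yh 0 0), 0, IsLocalRing.residue (Valued.integer (w.1.adicCompletion L)) (Yh 0 1); 0, 0, 0; IsLocalRing.residue (Valued.integer (w.1.adicCompletion L)) (Yh 1 0), 0, IsLocalRing.residue (Valued.integer (w.1.adicCompletion L)) (Yh 1 1)] : Matrix (Fin 3) (Fin 3) (Valued.ResidueField (w.1.adicCompletion L))) 2 0) +
        ε * quadraticChar (Valued.ResidueField (w.1.adicCompletion L)) (-2 * (IsLocalRing.residue (Valued.integer (w.1.adicCompletion L)) (-c₀))⁻¹) * ∑ v : Valued.ResidueField (w.1.adicCompletion L), quadraticChar (Valued.ResidueField (w.1.adicCompletion L)) (v + 2 * (!![IsLocalRing.residue (Valued.integer (w.1.adicCompletion L)) (Yh 0 0), 0, IsLocalRing.residue (Valued.integer (w.1.adicCompletion L)) (Yh 0 1); 0, 0, 0; IsLocalRing.residue (Valued.integer (w.1.adicCompletion L)) (Yh 1 0), 0, IsLocalRing.residue (Valued.integer (w.1.adicCompletion L)) (Yh 1 1)] : Matrix (Fin 3) (Fin 3) (Valued.ResidueField (w.1.adicCompletion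 L))) 0 0) * quadraticChar (Valued.ResidueField (w.1.adicCompletion L)) (v ^ 2 - 4 * ((!![IsLocalRing.residue (Valued.integer (w.1.adicCompletion L)) (Yh 0 0), 0, IsLocalRing.residue (Valued.integer (w.1.adicCompletion L)) (Yh 0 1); 0, 0, 0; IsLocalRing.residue (Valued.integer (w.1.adicCompletion L)) (Yh 1 0), 0, IsLocalRing.residue (Valued.integer (w.1.adicCompletion L)) (Yh 1 1)] : Matrix (Fin 3) (Fin 3) (Valued.ResidueField (w.1.adicCompletion L))) 0 2 * (!![IsLocalRing.residue (Valued.integer (w.1.adicCompletion L)) (Yh 0 0), 0, IsLocalRing.residue (Valued.integer (w.1.adicCompletion L)) (Yh 0 1); 0, 0, 0; IsLocalRing.residue (Valued.integer (w.1.adicCompletion L)) (Yh 1 0), 0, IsLocalRing.residue (Valued.integer (w.1.adicCompletion L)) (Yh 1 1)] : Matrix (Fin 3) (Fin 3) (Valued.ResidueField (w.1.adicCompletion L))) 2 0)) :=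
    fun ε hε => two_mul_natCard_params_iotaShape_quadraticChar_eq hk2 (!![IsLocalRing.residue (Valued.integer (w.1.adicCompletion L)) (Yh 0 0), 0, IsLocalRing.residue (Valued.integer (w.1.adicCompletion L)) (Yh 0 1); 0, 0, 0; IsLocalRing.residue (Valued.integer (w.1.adicCompletion L)) (Yh 1 0), 0, IsLocalRing.residue (Valued.integer (w.1.adicCompletion L)) (Yh 1 1)] : Matrix (Fin 3) (Fin 3) (Valued.ResidueField (w.1.adicCompletion L))) rfl rfl rfl rfl rfl hdiagh' hirrh' (IsLocalRing.residue (Valued.integer (w.1.adicCompletion L)) (-c₀))⁻¹ hc₀' hε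
  -- THE ANISOTROPIC ROOT `γa = P₁·ι(s γ₁, 1)·P₁⁻¹ ∈ U(σ_w, J₀)` (★ `conj_endoGL_centred_mem_unitaryGroupOfForm_of_formCongr_eq`)
  have huu : (galAdicCompletionMap (L := L) (IsCMField.complexConj L) hw) (finGammaTwo L v γH w) * finGammaTwo L v γH w = 1 := by
    have h := congrArg (fun y : LocalRing L v => y w) (conjLocal_finGammaTwo_mul_finGammaTwo L v γH)
    simpa only [Pi.mul_apply, Pi.one_apply, conjLocal_apply_eq_galAdicCompletionMap L v w hw] using h
  have hsnorm : (galAdicCompletionMap (L := L) (IsCMField.complexConj L) hw) (s : (w.1.adicCompletion L)) * (s : (w.1.adicCompletion L)) = 1 := norm_eq_one_of_mul_eq_one_of_norm_eq_one huu hsu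
  have hform' : formCongr (galAdicCompletionMap (L := L) (IsCMField.complexConj L) hw) P₁ ((StdForm.antidiagonal 3).over (w.1.adicCompletion L)) =
      !![(Matrix.diagonal d) 0 0, 0, (Matrix.diagonal d) 0 1; 0, η, 0; (Matrix.diagonal d) 1 0, 0, (Matrix.diagonal d) 1 1] := by
    rw [← placeForm_antidiagOne]; exact hform
  let γa : unitaryGroupOfForm (galAdicCompletionMap (L := L) (IsCMField.complexConj L) hw) ((StdForm.antidiagonal 3).over (w.1.adicCompletion L)) :=
    ⟨P₁ * endoGL (Matrix.GeneralLinearGroup.scalar (Fin 2) s * γ₁, (1 : GL (Fin 1) (w.1.adicCompletion L))) * P₁⁻¹, conj_endoGL_centred_mem_unitaryGroupOfForm_of_formCongr_eq hform' hγU s hsnorm⟩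
  have hγa : (γa : GL (Fin 3) (w.1.adicCompletion L)) = P₁ * endoGL (Matrix.GeneralLinearGroup.scalar (Fin 2) s * γ₁, (1 : GL (Fin 1) (w.1.adicCompletion L))) * P₁⁻¹ := rfl
  -- ★ p849702 (A-p16 (g33), ask (ii)): THE ANISOTROPIC ROOT CENSUS IN PARAMS CURRENCY (over ★ p849644 F0P2-p01 (g17) residual frame ∘ ★ p849483 ∘ ★ p849383)
  have Tan := BlockLawAniso.anisotropicRootCensus_params_odd_ram L w hw he h2 ϖ hϖ hσϖ γH hblk hu2 m hm hn β hβ hmN P₁ d η γ₁ hP₁ hform hdv hσd han₀ han₁ hση hηv hγ2 hγU hχ hdiscγ hirrγ hηN s hsu γa hγa c c₀ hc₀ hc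
  obtain ⟨Ar, δ, Ya, Tm, B, hYa, -, hG, hδ, -, hδ1, -, hYB, hB10, hB12, hB01, hB21, hB11, -, -, -, -, hadj, hirra, -, -, hNEa, hNPa, hNMa⟩ := Tan
  -- ★ p849291 (A-p16 (g33)): the socket totals `#an±(c)`
  have Ha := BlockLawAniso.anisotropicTotal_pm_ram_of_census_odd L w hw he h2 ϖ hϖ hσϖ γH hu2 m hm P₁ d η γ₁ hP₁ hform hdv hσd han₀ han₁ hση hηv hγ2 hγU hχ hirrγ hηN mA hmA s hsu γa hγa c hc _ _ _ hNEa hNPa hNMa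
  -- the anisotropic scalars (★ p849444 v2 heads, F0P3a-p02 (g18))
  have na := natCard_params_blockFrame_null_eq' hk2 (i₀ := 1) (j := 0) (l := 2) (by decide) (by decide) (by decide) δ hδ B hB10 hB12 hB01 hB21 hadj hirra Ar (Ya.map (IsLocalRing.residue (Valued.integer (w.1.adicCompletion L)))) hG hYB
  have ca : ∀ ε : ℤ, ε = 1 ∨ ε = -1 → 2 * ((Nat.card {p : Option {p : Valued.ResidueField (w.1.adicCompletion L) × Valued.ResidueField (w.1.adicCompletion L) // p.2 + (RingHom.id (Valued.ResidueField (w.1.adicCompletion L))) p.2 + p.1 * (RingHom.id (Valued.ResidueField (w.1.adicCompletion L))) p.1 = 0} // quadraticChar (Valued.ResidueField (w.1.adicCompletion L)) ((IsLocalRing.residue (Valued.integer (w.1.adicCompletion L)) (-c₀))⁻¹ * ((p.elim (Pi.single 2 1) fun q => ![(1 : Valued.ResidueField (w.1.adicCompletion L)), q.1.1, q.1.2]) ⬝ᵥ ((((((StdForm.antidiagonal 3).over (Valued.ResidueField (w.1.adicCompletion L)))) * (Ya.map (IsLocalRing.residue (Valued.integer (w.1.adicCompletion L))))) *ᵥ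 (p.elim (Pi.single 2 1) fun q => ![(1 : Valued.ResidueField (w.1.adicCompletion L)), q.1.1, q.1.2]))))) = ε} : ℕ) : ℤ) =
      Fintype.card (Valued.ResidueField (w.1.adicCompletion L)) - quadraticChar (Valued.ResidueField (w.1.adicCompletion L)) (δ 0 * δ 2 * (B 0 2 * B 2 0 - (B 0 0 - B 1 1) * (B 2 2 - B 1 1))) +
        ε * quadraticChar (Valued.ResidueField (w.1.adicCompletion L)) (2 * (IsLocalRing.residue (Valued.integer (w.1.adicCompletion L)) (-c₀))⁻¹ * δ 1 * δ 0 * δ 2) *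
          ∑ v : Valued.ResidueField (w.1.adicCompletion L), quadraticChar (Valued.ResidueField (w.1.adicCompletion L)) (v + (B 0 0 + B 2 2 - 2 * B 1 1)) * quadraticChar (Valued.ResidueField (w.1.adicCompletion L)) (v ^ 2 - ((B 0 0 - B 2 2) ^ 2 + 4 * (B 0 2 * B 2 0))) :=
    fun ε hε => two_mul_natCard_params_blockFrame_quadraticChar_eq' hk2 (i₀ := 1) (j := 0) (l := 2) (by decide) (by decide) (by decide) δ hδ B hB10 hB12 hB01 hB21 hadj hirra Ar (Ya.map (IsLocalRing.residue (Valued.integer (w.1.adicCompletion L)))) hG hYB (IsLocalRing.residue (Valued.integer (w.1.adicCompletion L)) (-c₀))⁻¹ hc₀' hε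
  -- THE SPECTRAL TIE (chair ★ p849471 + conjugation invariance): `tr Ȳa = tr Ȳh`, `tr Ȳa² = tr Ȳh²`
  have Ttie := trace_det_centred_blocks_agree_ram L w hw γ₁ hχ s k
  obtain ⟨htr, -, hsq⟩ := Ttie
  have TE := trace_coe_conj_endoGL_one_sub_one P₁ (Matrix.GeneralLinearGroup.scalar (Fin 2) s * γ₁ : GL (Fin 2) (w.1.adicCompletion L))
  obtain ⟨hEtr, hEsq⟩ := TE
  have TYa := coe_trace_fin_three_of_leading ((ϖ ^ m)⁻¹) _ Ya hYa
  obtain ⟨hYaT, hYaS⟩ := TYa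
  have TYh2 := coe_trace_fin_two_of_leading ((ϖ ^ m)⁻¹) _ Yh hYh
  obtain ⟨hYhT, hYhS⟩ := TYh2
  have hTO : Ya.trace = Yh.trace := by
    apply Subtype.ext
    rw [hYaT, hYhT, hγa, hEtr, ← htr]
  have hSO : (Ya * Ya).trace = (Yh * Yh).trace := by
    apply Subtype.ext
    rw [hYaS, hYhS, hγa, hEsq, ← hsq]
  have hTk : ((Ya.map (IsLocalRing.residue (Valued.integer (w.1.adicCompletion L))))).trace = IsLocalRing.residue (Valued.integer (w.1.adicCompletion L)) (Yh 0 0) + IsLocalRing.residue (Valued.integer (w.1.adicCompletion L)) (Yh 1 1) := by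
    rw [trace_map_residue, hTO, Matrix.trace_fin_two, map_add]
  have hSk : ((Ya.map (IsLocalRing.residue (Valued.integer (w.1.adicCompletion L)))) * (Ya.map (IsLocalRing.residue (Valued.integer (w.1.adicCompletion L))))).trace = IsLocalRing.residue (Valued.integer (w.1.adicCompletion L)) (Yh 0 0) ^ 2 + 2 * (IsLocalRing.residue (Valued.integer (w.1.adicCompletion L)) (Yh 0 1) * IsLocalRing.residue (Valued.integer (w.1.adicCompletion L)) (Yh 1 0)) + IsLocalRing.residue (Valued.integer (w.1.adicCompletion L)) (Yh 1 1) ^ 2 := by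
    rw [← Matrix.map_mul, trace_map_residue, hSO, Matrix.trace_fin_two]
    simp only [Matrix.mul_apply, Fin.sum_univ_two, map_add, map_mul]
    ring
  -- the block-frame glue (chair): relative trace ∕ determinant of `B` against `tr Ȳa`, `tr Ȳa²`
  have e1 := SpectralTie.blockFrame_relTrace_eq Ar (Ya.map (IsLocalRing.residue (Valued.integer (w.1.adicCompletion L)))) B hYB (i₀ := 1) (j := 0) (l := 2) (by decide) (by decide) (by decide)
  have e2 := SpectralTie.two_mul_blockFrame_relDet_eq Ar (Ya.map (IsLocalRing.residue (Valued.integer (w.1.adicCompletion L)))) B hYB (i₀ := 1) (j := 0) (l := 2) (by decide) (by decide) (by decide) hB10 hB12 hB01 hB21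
  rw [hTk] at e1
  rw [hTk, hSk] at e2
  have h2k : (2 : Valued.ResidueField (w.1.adicCompletion L)) ≠ 0 := Ring.two_ne_zero hk2
  have hT : B 0 0 + B 2 2 - 2 * B 1 1 = 2 * (!![IsLocalRing.residue (Valued.integer (w.1.adicCompletion L)) (Yh 0 0), 0, IsLocalRing.residue (Valued.integer (w.1.adicCompletion L)) (Yh 0 1); 0, 0, 0; IsLocalRing.residue (Valued.integer (w.1.adicCompletion L)) (Yh 1 0), 0, IsLocalRing.residue (Valued.integer (w.1.adicCompletion L)) (Yh 1 1)] : Matrix (Fin 3) (Fin 3) (Valued.ResidueField (w.1.adicCompletion L))) 0 0 := by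
    simp only [Matrix.of_apply, Matrix.cons_val', Matrix.cons_val_zero, Matrix.empty_val', Matrix.cons_val_fin_one]
    rw [hB11] at e1 ⊢; rw [← hdiagh] at e1; linear_combination e1
  have hDet : B 0 2 * B 2 0 - (B 0 0 - B 1 1) * (B 2 2 - B 1 1) = -((!![IsLocalRing.residue (Valued.integer (w.1.adicCompletion L)) (Yh 0 0), 0, IsLocalRing.residue (Valued.integer (w.1.adicCompletion L)) (Yh 0 1); 0, 0, 0; IsLocalRing.residue (Valued.integer (w.1.adicCompletion L)) (Yh 1 0), 0, IsLocalRing.residue (Valued.integer (w.1.adicCompletion L)) (Yh 1 1)] : Matrix (Fin 3) (Fin 3) (Valued.ResidueField (w.1.adicCompletion L))) 0 0 ^ 2 - (!![IsLocalRing.residue (Valued.integer (w.1.adicCompletion L)) (Yh 0 0), 0, IsLocalRing.residue (Valued.integer (w.1.adicCompletion L)) (Yh 0 1); 0, 0, 0; IsLocalRing.residue (Valued.integer (w.1.adicCompletion L)) (Yh 1 0), 0, IsLocalRing.residue (Valued.integer (w.1.adicCompletion L)) (Yh 1 1)] : Matrix (Fin 3) (Fin 3) (Valued.ResidueField (w.1.adicCompletion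 L))) 0 2 * (!![IsLocalRing.residue (Valued.integer (w.1.adicCompletion L)) (Yh 0 0), 0, IsLocalRing.residue (Valued.integer (w.1.adicCompletion L)) (Yh 0 1); 0, 0, 0; IsLocalRing.residue (Valued.integer (w.1.adicCompletion L)) (Yh 1 0), 0, IsLocalRing.residue (Valued.integer (w.1.adicCompletion L)) (Yh 1 1)] : Matrix (Fin 3) (Fin 3) (Valued.ResidueField (w.1.adicCompletion L))) 2 0) := by
    simp only [Matrix.of_apply, Matrix.cons_val', Matrix.cons_val_zero, Matrix.cons_val_two, Matrix.empty_val', Matrix.cons_val_fin_one, Matrix.tail_cons, Matrix.head_cons, Matrix.head_fin_const]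
    rw [hB11] at e1 e2 ⊢; rw [← hdiagh] at e2
    apply mul_left_cancel₀ h2k
    linear_combination e2
  have hD : (B 0 0 - B 2 2) ^ 2 + 4 * (B 0 2 * B 2 0) = 4 * ((!![IsLocalRing.residue (Valued.integer (w.1.adicCompletion L)) (Yh 0 0), 0, IsLocalRing.residue (Valued.integer (w.1.adicCompletion L)) (Yh 0 1); 0, 0, 0; IsLocalRing.residue (Valued.integer (w.1.adicCompletion L)) (Yh 1 0), 0, IsLocalRing.residue (Valued.integer (w.1.adicCompletion L)) (Yh 1 1)] : Matrix (Fin 3) (Fin 3) (Valued.ResidueField (w.1.adicCompletion L))) 0 2 * (!![IsLocalRing.residue (Valued.integer (w.1.adicCompletion L)) (Yh 0 0), 0, IsLocalRing.residue (Valued.integer (w.1.adicCompletion L)) (Yh 0 1); 0, 0, 0; IsLocalRing.residue (Valued.integer (w.1.adicCompletion L)) (Yh 1 0), 0, IsLocalRing.residue (Valued.integer (w.1.adicCompletion L)) (Yh 1 1)] : Matrix (Fin 3) (Fin 3) (Valued.ResidueField (w.1.adicCompletion L))) 2 0) := by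
    have e3 := hDet
    simp only [Matrix.of_apply, Matrix.cons_val', Matrix.cons_val_zero, Matrix.cons_val_two, Matrix.empty_val', Matrix.cons_val_fin_one, Matrix.tail_cons, Matrix.head_cons, Matrix.head_fin_const] at e3 ⊢
    rw [hB11] at e1 e3; rw [← hdiagh] at e1
    linear_combination (B 0 0 + B 2 2 + 2 * IsLocalRing.residue (Valued.integer (w.1.adicCompletion L)) (Yh 0 0)) * e1 + 4 * e3
  -- the two line tokens: `t_h = χ(det Ȳh_W)`, `t_a = −t_h` (`χ(η̄) = −1`)
  have hdetk : IsLocalRing.residue (Valued.integer (w.1.adicCompletion L)) (Yh 0 0 * Yh 1 1 - Yh 0 1 * Yh 1 0) = (!![IsLocalRing.residue (Valued.integer (w.1.adicCompletion L)) (Yh 0 0), 0, IsLocalRing.residue (Valued.integer (w.1.adicCompletion L)) (Yh 0 1); 0, 0, 0; IsLocalRing.residue (Valued.integer (w.1.adicCompletion L)) (Yh 1 0), 0, IsLocalRing.residue (Valued.integer (w.1.adicCompletion L)) (Yh 1 1)] : Matrix (Fin 3) (Fin 3) (Valued.ResidueField (w.1.adicCompletion L))) 0 0 ^ 2 - (!![IsLocalRing.residue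 (Valued.integer (w.1.adicCompletion L)) (Yh 0 0), 0, IsLocalRing.residue (Valued.integer (w.1.adicCompletion L)) (Yh 0 1); 0, 0, 0; IsLocalRing.residue (Valued.integer (w.1.adicCompletion L)) (Yh 1 0), 0, IsLocalRing.residue (Valued.integer (w.1.adicCompletion L)) (Yh 1 1)] : Matrix (Fin 3) (Fin 3) (Valued.ResidueField (w.1.adicCompletion L))) 0 2 * (!![IsLocalRing.residue (Valued.integer (w.1.adicCompletion L)) (Yh 0 0), 0, IsLocalRing.residue (Valued.integer (w.1.adicCompletion L)) (Yh 0 1); 0, 0, 0; IsLocalRing.residue (Valued.integer (w.1.adicCompletion L)) (Yh 1 0), 0, IsLocalRing.residue (Valued.integer (w.1.adicCompletion L)) (Yh 1 1)] : Matrix (Fin 3) (Fin 3) (Valued.ResidueField (w.1.adicCompletion L))) 2 0 := by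
    simp only [Matrix.of_apply, Matrix.cons_val', Matrix.cons_val_zero, Matrix.cons_val_two, Matrix.empty_val', Matrix.cons_val_fin_one, Matrix.tail_cons, Matrix.head_cons, Matrix.head_fin_const]
    rw [map_sub, map_mul, map_mul, ← hdiagh]; ring
  have hx0 : (!![IsLocalRing.residue (Valued.integer (w.1.adicCompletion L)) (Yh 0 0), 0, IsLocalRing.residue (Valued.integer (w.1.adicCompletion L)) (Yh 0 1); 0, 0, 0; IsLocalRing.residue (Valued.integer (w.1.adicCompletion L)) (Yh 1 0), 0, IsLocalRing.residue (Valued.integer (w.1.adicCompletion L)) (Yh 1 1)] : Matrix (Fin 3) (Fin 3) (Valued.ResidueField (w.1.adicCompletion L))) 0 0 ^ 2 - (!![IsLocalRing.residue (Valued.integer (w.1.adicCompletion L)) (Yh 0 0), 0, IsLocalRing.residue (Valued.integer (w.1.adicCompletion L)) (Yh 0 1); 0, 0, 0; IsLocalRing.residue (Valued.integer (w.1.adicCompletion L)) (Yh 1 0), 0, IsLocalRing.residue (Valued.integer (w.1.adicCompletion L)) (Yh 1 1)] : Matrix (Fin 3) (Fin 3) (Valued.ResidueField (w.1.adicCompletion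 L))) 0 2 * (!![IsLocalRing.residue (Valued.integer (w.1.adicCompletion L)) (Yh 0 0), 0, IsLocalRing.residue (Valued.integer (w.1.adicCompletion L)) (Yh 0 1); 0, 0, 0; IsLocalRing.residue (Valued.integer (w.1.adicCompletion L)) (Yh 1 0), 0, IsLocalRing.residue (Valued.integer (w.1.adicCompletion L)) (Yh 1 1)] : Matrix (Fin 3) (Fin 3) (Valued.ResidueField (w.1.adicCompletion L))) 2 0 ≠ 0 := by
    intro h0
    have hirr2 := hirrh'
    rw [(sub_eq_zero.1 h0).symm] at hirr2
    by_cases hr : (!![IsLocalRing.residue (Valued.integer (w.1.adicCompletion L)) (Yh 0 0), 0, IsLocalRing.residue (Valued.integer (w.1.adicCompletion L)) (Yh 0 1); 0, 0, 0; IsLocalRing.residue (Valued.integer (w.1.adicCompletion L)) (Yh 1 0), 0, IsLocalRing.residue (Valued.integer (w.1.adicCompletion L)) (Yh 1 1)] : Matrix (Fin 3) (Fin 3) (Valued.ResidueField (w.1.adicCompletion L))) 0 0 = 0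
    · rw [hr, zero_pow two_ne_zero, MulChar.map_zero] at hirr2; norm_num at hirr2
    · rw [quadraticChar_sq_one' hr] at hirr2; norm_num at hirr2
  have hta : quadraticChar (Valued.ResidueField (w.1.adicCompletion L)) (δ 0 * δ 2 * (B 0 2 * B 2 0 - (B 0 0 - B 1 1) * (B 2 2 - B 1 1))) =
      -quadraticChar (Valued.ResidueField (w.1.adicCompletion L)) ((!![IsLocalRing.residue (Valued.integer (w.1.adicCompletion L)) (Yh 0 0), 0, IsLocalRing.residue (Valued.integer (w.1.adicCompletion L)) (Yh 0 1); 0, 0, 0; IsLocalRing.residue (Valued.integer (w.1.adicCompletion L)) (Yh 1 0), 0, IsLocalRing.residue (Valued.integer (w.1.adicCompletion L)) (Yh 1 1)] : Matrix (Fin 3) (Fin 3) (Valued.ResidueField (w.1.adicCompletion L))) 0 0 ^ 2 - (!![IsLocalRing.residue (Valued.integer (w.1.adicCompletion L)) (Yh 0 0), 0, IsLocalRing.residue (Valued.integer (w.1.adicCompletion L)) (Yh 0 1); 0, 0, 0; IsLocalRing.residue (Valued.integer (w.1.adicCompletion L)) (Yh 1 0), 0, IsLocalRing.residue (Valued.integer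 (w.1.adicCompletion L)) (Yh 1 1)] : Matrix (Fin 3) (Fin 3) (Valued.ResidueField (w.1.adicCompletion L))) 0 2 * (!![IsLocalRing.residue (Valued.integer (w.1.adicCompletion L)) (Yh 0 0), 0, IsLocalRing.residue (Valued.integer (w.1.adicCompletion L)) (Yh 0 1); 0, 0, 0; IsLocalRing.residue (Valued.integer (w.1.adicCompletion L)) (Yh 1 0), 0, IsLocalRing.residue (Valued.integer (w.1.adicCompletion L)) (Yh 1 1)] : Matrix (Fin 3) (Fin 3) (Valued.ResidueField (w.1.adicCompletion L))) 2 0) := by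
    rw [quadraticChar_plane_mul_eq_of_frame (i₀ := 1) (j := 0) (l := 2) (by decide) (by decide) (by decide) δ (hδ 1) Ar hG, hDet,
      ← map_mul, show -δ 1 * -((!![IsLocalRing.residue (Valued.integer (w.1.adicCompletion L)) (Yh 0 0), 0, IsLocalRing.residue (Valued.integer (w.1.adicCompletion L)) (Yh 0 1); 0, 0, 0; IsLocalRing.residue (Valued.integer (w.1.adicCompletion L)) (Yh 1 0), 0, IsLocalRing.residue (Valued.integer (w.1.adicCompletion L)) (Yh 1 1)] : Matrix (Fin 3) (Fin 3) (Valued.ResidueField (w.1.adicCompletion L))) 0 0 ^ 2 - (!![IsLocalRing.residue (Valued.integer (w.1.adicCompletion L)) (Yh 0 0), 0, IsLocalRing.residue (Valued.integer (w.1.adicCompletion L)) (Yh 0 1); 0, 0, 0; IsLocalRing.residue (Valued.integer (w.1.adicCompletion L)) (Yh 1 0), 0, IsLocalRing.residue (Valued.integer (w.1.adicCompletion L)) (Yh 1 1)] : Matrix (Fin 3) (Fin 3) (Valued.ResidueField (w.1.adicCompletion L))) 0 2 * (!![IsLocalRing.residue (Valued.integer (w.1.adicCompletion L)) (Yh 0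 0), 0, IsLocalRing.residue (Valued.integer (w.1.adicCompletion L)) (Yh 0 1); 0, 0, 0; IsLocalRing.residue (Valued.integer (w.1.adicCompletion L)) (Yh 1 0), 0, IsLocalRing.residue (Valued.integer (w.1.adicCompletion L)) (Yh 1 1)] : Matrix (Fin 3) (Fin 3) (Valued.ResidueField (w.1.adicCompletion L))) 2 0) = δ 1 * ((!![IsLocalRing.residue (Valued.integer (w.1.adicCompletion L)) (Yh 0 0), 0, IsLocalRing.residue (Valued.integer (w.1.adicCompletion L)) (Yh 0 1); 0, 0, 0; IsLocalRing.residue (Valued.integer (w.1.adicCompletion L)) (Yh 1 0), 0, IsLocalRing.residue (Valued.integer (w.1.adicCompletion L)) (Yh 1 1)] : Matrix (Fin 3) (Fin 3) (Valued.ResidueField (w.1.adicCompletion L))) 0 0 ^ 2 - (!![IsLocalRing.residue (Valued.integer (w.1.adicCompletion L)) (Yh 0 0), 0, IsLocalRing.residue (Valued.integer (w.1.adicCompletion L)) (Yh 0 1); 0, 0, 0; IsLocalRing.residue (Valued.integer (w.1.adicCompletion L)) (Yh 1 0), 0, IsLocalRing.residue (Valued.integer (w.1.adicCompletion L)) (Yh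 1 1)] : Matrix (Fin 3) (Fin 3) (Valued.ResidueField (w.1.adicCompletion L))) 0 2 * (!![IsLocalRing.residue (Valued.integer (w.1.adicCompletion L)) (Yh 0 0), 0, IsLocalRing.residue (Valued.integer (w.1.adicCompletion L)) (Yh 0 1); 0, 0, 0; IsLocalRing.residue (Valued.integer (w.1.adicCompletion L)) (Yh 1 0), 0, IsLocalRing.residue (Valued.integer (w.1.adicCompletion L)) (Yh 1 1)] : Matrix (Fin 3) (Fin 3) (Valued.ResidueField (w.1.adicCompletion L))) 2 0) by ring, map_mul, hδ1]
    ring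
  -- `κ_h·J_h = κ_a·J_a`
  have hκ : quadraticChar (Valued.ResidueField (w.1.adicCompletion L)) (2 * (IsLocalRing.residue (Valued.integer (w.1.adicCompletion L)) (-c₀))⁻¹ * δ 1 * δ 0 * δ 2) = quadraticChar (Valued.ResidueField (w.1.adicCompletion L)) (-2 * (IsLocalRing.residue (Valued.integer (w.1.adicCompletion L)) (-c₀))⁻¹) := by
    rw [quadraticChar_mul_frame_prod_eq (i₀ := 1) (j := 0) (l := 2) (by decide) (by decide) (by decide) δ Ar hG, neg_mul]
  have hJ : ∑ v : Valued.ResidueField (w.1.adicCompletion L), quadraticChar (Valued.ResidueField (w.1.adicCompletion L)) (v + (B 0 0 + B 2 2 - 2 * B 1 1)) * quadraticChar (Valued.ResidueField (w.1.adicCompletion L)) (v ^ 2 - ((B 0 0 - B 2 2) ^ 2 + 4 * (B 0 2 * B 2 0))) =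
      ∑ v : Valued.ResidueField (w.1.adicCompletion L), quadraticChar (Valued.ResidueField (w.1.adicCompletion L)) (v + 2 * (!![IsLocalRing.residue (Valued.integer (w.1.adicCompletion L)) (Yh 0 0), 0, IsLocalRing.residue (Valued.integer (w.1.adicCompletion L)) (Yh 0 1); 0, 0, 0; IsLocalRing.residue (Valued.integer (w.1.adicCompletion L)) (Yh 1 0), 0, IsLocalRing.residue (Valued.integer (w.1.adicCompletion L)) (Yh 1 1)] : Matrix (Fin 3) (Fin 3) (Valued.ResidueField (w.1.adicCompletion L))) 0 0) * quadraticChar (Valued.ResidueField (w.1.adicCompletion L)) (v ^ 2 - 4 * ((!![IsLocalRing.residue (Valued.integer (w.1.adicCompletion L)) (Yh 0 0), 0, IsLocalRing.residue (Valued.integer (w.1.adicCompletion L)) (Yh 0 1); 0, 0, 0; IsLocalRing.residue (Valued.integer (w.1.adicCompletion L)) (Yh 1 0), 0, IsLocalRing.residue (Valued.integer (w.1.adicCompletion L)) (Yh 1 1)] : Matrix (Fin 3) (Fin 3) (Valued.ResidueField (w.1.adicCompletion L))) 0 2 * (!![IsLocalRing.residue (Valued.integer (w.1.adicCompletion L))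 (Yh 0 0), 0, IsLocalRing.residue (Valued.integer (w.1.adicCompletion L)) (Yh 0 1); 0, 0, 0; IsLocalRing.residue (Valued.integer (w.1.adicCompletion L)) (Yh 1 0), 0, IsLocalRing.residue (Valued.integer (w.1.adicCompletion L)) (Yh 1 1)] : Matrix (Fin 3) (Fin 3) (Valued.ResidueField (w.1.adicCompletion L))) 2 0)) :=
    Finset.sum_congr rfl fun v _ => by rw [hT, hD]
  have hκJ : quadraticChar (Valued.ResidueField (w.1.adicCompletion L)) (-2 * (IsLocalRing.residue (Valued.integer (w.1.adicCompletion L)) (-c₀))⁻¹) * (∑ v : Valued.ResidueField (w.1.adicCompletion L), quadraticChar (Valued.ResidueField (w.1.adicCompletion L)) (v + 2 * (!![IsLocalRing.residue (Valued.integer (w.1.adicCompletion L)) (Yh 0 0), 0, IsLocalRing.residue (Valued.integer (w.1.adicCompletion L)) (Yh 0 1); 0, 0, 0; IsLocalRing.residue (Valued.integer (w.1.adicCompletion L)) (Yh 1 0), 0, IsLocalRing.residue (Valued.integer (w.1.adicCompletion L)) (Yh 1 1)] : Matrix (Fin 3) (Fin 3) (Valued.ResidueField (w.1.adicCompletion L)))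 0 0) * quadraticChar (Valued.ResidueField (w.1.adicCompletion L)) (v ^ 2 - 4 * ((!![IsLocalRing.residue (Valued.integer (w.1.adicCompletion L)) (Yh 0 0), 0, IsLocalRing.residue (Valued.integer (w.1.adicCompletion L)) (Yh 0 1); 0, 0, 0; IsLocalRing.residue (Valued.integer (w.1.adicCompletion L)) (Yh 1 0), 0, IsLocalRing.residue (Valued.integer (w.1.adicCompletion L)) (Yh 1 1)] : Matrix (Fin 3) (Fin 3) (Valued.ResidueField (w.1.adicCompletion L))) 0 2 * (!![IsLocalRing.residue (Valued.integer (w.1.adicCompletion L)) (Yh 0 0), 0, IsLocalRing.residue (Valued.integer (w.1.adicCompletion L)) (Yh 0 1); 0, 0, 0; IsLocalRing.residue (Valued.integer (w.1.adicCompletion L)) (Yh 1 0), 0, IsLocalRing.residue (Valued.integer (w.1.adicCompletion L)) (Yh 1 1)] : Matrix (Fin 3) (Fin 3) (Valued.ResidueField (w.1.adicCompletion L))) 2 0))) =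
      quadraticChar (Valued.ResidueField (w.1.adicCompletion L)) (2 * (IsLocalRing.residue (Valued.integer (w.1.adicCompletion L)) (-c₀))⁻¹ * δ 1 * δ 0 * δ 2) *
        ∑ v : Valued.ResidueField (w.1.adicCompletion L), quadraticChar (Valued.ResidueField (w.1.adicCompletion L)) (v + (B 0 0 + B 2 2 - 2 * B 1 1)) * quadraticChar (Valued.ResidueField (w.1.adicCompletion L)) (v ^ 2 - ((B 0 0 - B 2 2) ^ 2 + 4 * (B 0 2 * B 2 0))) := by
    rw [hκ, hJ]
  -- THE SIGN DICHOTOMY and the bookkeeping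
  have THS := hilbertSymbol_eq_one_or_eq_neg_one (β : v.adicCompletion ↥(maximalRealSubfield L)) (algebraMap ↥(maximalRealSubfield L) _ ((cmQuadraticGenerator L : 𝓞 ↥(maximalRealSubfield L)) : ↥(maximalRealSubfield L)))
  rcases THS with hHS | hHS
  · -- the hyperbolic root is favourable
    have hth : quadraticChar (Valued.ResidueField (w.1.adicCompletion L)) ((!![IsLocalRing.residue (Valued.integer (w.1.adicCompletion L)) (Yh 0 0), 0, IsLocalRing.residue (Valued.integer (w.1.adicCompletion L)) (Yh 0 1); 0, 0, 0; IsLocalRing.residue (Valued.integer (w.1.adicCompletion L)) (Yh 1 0), 0, IsLocalRing.residue (Valued.integer (w.1.adicCompletion L)) (Yh 1 1)] : Matrix (Fin 3) (Fin 3) (Valued.ResidueField (w.1.adicCompletion L))) 0 0 ^ 2 - (!![IsLocalRing.residue (Valued.integer (w.1.adicCompletion L)) (Yh 0 0), 0, IsLocalRing.residue (Valued.integer (w.1.adicCompletion L)) (Yh 0 1); 0, 0, 0; IsLocalRing.residue (Valued.integer (w.1.adicCompletion L)) (Yh 1 0), 0, IsLocalRing.residue (Valued.integer (w.1.adicCompletion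 L)) (Yh 1 1)] : Matrix (Fin 3) (Fin 3) (Valued.ResidueField (w.1.adicCompletion L))) 0 2 * (!![IsLocalRing.residue (Valued.integer (w.1.adicCompletion L)) (Yh 0 0), 0, IsLocalRing.residue (Valued.integer (w.1.adicCompletion L)) (Yh 0 1); 0, 0, 0; IsLocalRing.residue (Valued.integer (w.1.adicCompletion L)) (Yh 1 0), 0, IsLocalRing.residue (Valued.integer (w.1.adicCompletion L)) (Yh 1 1)] : Matrix (Fin 3) (Fin 3) (Valued.ResidueField (w.1.adicCompletion L))) 2 0) = 1 := by rw [← hdetk]; exact hHSh.1 hHS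
    have hta' : quadraticChar (Valued.ResidueField (w.1.adicCompletion L)) (δ 0 * δ 2 * (B 0 2 * B 2 0 - (B 0 0 - B 1 1) * (B 2 2 - B 1 1))) = -1 := by rw [hta, hth]
    have Trel := crossLiteral_lineRelations'
      (cf := fun ε => Nat.card {p : Option {p : Valued.ResidueField (w.1.adicCompletion L) × Valued.ResidueField (w.1.adicCompletion L) // p.2 + (RingHom.id (Valued.ResidueField (w.1.adicCompletion L))) p.2 + p.1 * (RingHom.id (Valued.ResidueField (w.1.adicCompletion L))) p.1 = 0} // quadraticChar (Valued.ResidueField (w.1.adicCompletion L)) ((IsLocalRing.residue (Valued.integer (w.1.adicCompletion L)) (-c₀))⁻¹ * ((p.elim (Pi.single 2 1) fun q => ![(1 : Valued.ResidueField (w.1.adicCompletion L)), q.1.1, q.1.2]) ⬝ᵥ ((((((StdForm.antidiagonal 3).over (Valued.ResidueField (w.1.adicCompletion L)))) * (!![IsLocalRing.residue (Valued.integer (w.1.adicCompletion L)) (Yh 0 0), 0, IsLocalRing.residue (Valued.integer (w.1.adicCompletion L)) (Yh 0 1); 0, 0, 0; IsLocalRing.residue (Valued.integer (w.1.adicCompletion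 L)) (Yh 1 0), 0, IsLocalRing.residue (Valued.integer (w.1.adicCompletion L)) (Yh 1 1)] : Matrix (Fin 3) (Fin 3) (Valued.ResidueField (w.1.adicCompletion L)))) *ᵥ (p.elim (Pi.single 2 1) fun q => ![(1 : Valued.ResidueField (w.1.adicCompletion L)), q.1.1, q.1.2]))))) = ε})
      (cu := fun ε => Nat.card {p : Option {p : Valued.ResidueField (w.1.adicCompletion L) × Valued.ResidueField (w.1.adicCompletion L) // p.2 + (RingHom.id (Valued.ResidueField (w.1.adicCompletion L))) p.2 + p.1 * (RingHom.id (Valued.ResidueField (w.1.adicCompletion L))) p.1 = 0} // quadraticChar (Valued.ResidueField (w.1.adicCompletion L)) ((IsLocalRing.residue (Valued.integer (w.1.adicCompletion L)) (-c₀))⁻¹ * ((p.elim (Pi.single 2 1) fun q => ![(1 : Valued.ResidueField (w.1.adicCompletion L)), q.1.1, q.1.2]) ⬝ᵥ ((((((StdForm.antidiagonal 3).over (Valued.ResidueField (w.1.adicCompletion L)))) * (Ya.map (IsLocalRing.residue (Valued.integer (w.1.adicCompletion L))))) *ᵥ (p.elim (Pi.single 2 1) fun q => ![(1 : Valued.ResidueField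 (w.1.adicCompletion L)), q.1.1, q.1.2]))))) = ε})
      nh na ch ca hth hta' hκJ
    obtain ⟨r0h, r0a, rε, -⟩ := Trel
    have Tbk := pair_bookkeeping hqN Hh.1 Hh.2 Ha.1 Ha.2 r0h r0a (rε 1 (Or.inl rfl)) (rε (-1) (Or.inr rfl))
    obtain ⟨NE, FP, FM, UP, UM, ⟨e₁, e₂, e₃, e₄⟩, r₁, r₂, r₃⟩ := Tbk
    exact ⟨NE, FP, FM, UP, UM, Or.inl ⟨e₁, e₂, e₃, e₄, hHS⟩, r₁, r₂, r₃⟩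
  · -- the anisotropic root is favourable
    have hth : quadraticChar (Valued.ResidueField (w.1.adicCompletion L)) ((!![IsLocalRing.residue (Valued.integer (w.1.adicCompletion L)) (Yh 0 0), 0, IsLocalRing.residue (Valued.integer (w.1.adicCompletion L)) (Yh 0 1); 0, 0, 0; IsLocalRing.residue (Valued.integer (w.1.adicCompletion L)) (Yh 1 0), 0, IsLocalRing.residue (Valued.integer (w.1.adicCompletion L)) (Yh 1 1)] : Matrix (Fin 3) (Fin 3) (Valued.ResidueField (w.1.adicCompletion L))) 0 0 ^ 2 - (!![IsLocalRing.residue (Valued.integer (w.1.adicCompletion L)) (Yh 0 0), 0, IsLocalRing.residue (Valued.integer (w.1.adicCompletion L)) (Yh 0 1); 0, 0, 0; IsLocalRing.residue (Valued.integer (w.1.adicCompletion L)) (Yh 1 0), 0, IsLocalRing.residue (Valued.integer (w.1.adicCompletion L)) (Yh 1 1)] : Matrix (Fin 3) (Fin 3) (Valued.ResidueField (w.1.adicCompletion L))) 0 2 * (!![IsLocalRing.residue (Valued.integer (w.1.adicCompletion L)) (Yh 0 0), 0, IsLocalRing.residue (Valued.integer (w.1.adicCompletion L)) (Yh 0 1);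 0, 0, 0; IsLocalRing.residue (Valued.integer (w.1.adicCompletion L)) (Yh 1 0), 0, IsLocalRing.residue (Valued.integer (w.1.adicCompletion L)) (Yh 1 1)] : Matrix (Fin 3) (Fin 3) (Valued.ResidueField (w.1.adicCompletion L))) 2 0) = -1 := by
      refine (quadraticChar_eq_neg_one_iff_not_one hx0).2 fun h1 => ?_
      have h' := hHSh.2 (by rw [hdetk]; exact h1)
      rw [hHS] at h'; norm_num at h'
    have hta' : quadraticChar (Valued.ResidueField (w.1.adicCompletion L)) (δ 0 * δ 2 * (B 0 2 * B 2 0 - (B 0 0 - B 1 1) * (B 2 2 - B 1 1))) = 1 := by rw [hta, hth]; norm_num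
    have Trel := crossLiteral_lineRelations'
      (cf := fun ε => Nat.card {p : Option {p : Valued.ResidueField (w.1.adicCompletion L) × Valued.ResidueField (w.1.adicCompletion L) // p.2 + (RingHom.id (Valued.ResidueField (w.1.adicCompletion L))) p.2 + p.1 * (RingHom.id (Valued.ResidueField (w.1.adicCompletion L))) p.1 = 0} // quadraticChar (Valued.ResidueField (w.1.adicCompletion L)) ((IsLocalRing.residue (Valued.integer (w.1.adicCompletion L)) (-c₀))⁻¹ * ((p.elim (Pi.single 2 1) fun q => ![(1 : Valued.ResidueField (w.1.adicCompletion L)), q.1.1, q.1.2]) ⬝ᵥ ((((((StdForm.antidiagonal 3).over (Valued.ResidueField (w.1.adicCompletion L)))) * (Ya.map (IsLocalRing.residue (Valued.integer (w.1.adicCompletion L))))) *ᵥ (p.elim (Pi.single 2 1) fun q => ![(1 : Valued.ResidueField (w.1.adicCompletion L)), q.1.1, q.1.2]))))) = ε})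
      (cu := fun ε => Nat.card {p : Option {p : Valued.ResidueField (w.1.adicCompletion L) × Valued.ResidueField (w.1.adicCompletion L) // p.2 + (RingHom.id (Valued.ResidueField (w.1.adicCompletion L))) p.2 + p.1 * (RingHom.id (Valued.ResidueField (w.1.adicCompletion L))) p.1 = 0} // quadraticChar (Valued.ResidueField (w.1.adicCompletion L)) ((IsLocalRing.residue (Valued.integer (w.1.adicCompletion L)) (-c₀))⁻¹ * ((p.elim (Pi.single 2 1) fun q => ![(1 : Valued.ResidueField (w.1.adicCompletion L)), q.1.1, q.1.2]) ⬝ᵥ ((((((StdForm.antidiagonal 3).over (Valued.ResidueField (w.1.adicCompletion L)))) * (!![IsLocalRing.residue (Valued.integer (w.1.adicCompletion L)) (Yh 0 0), 0, IsLocalRing.residue (Valued.integer (w.1.adicCompletion L)) (Yh 0 1); 0, 0, 0; IsLocalRing.residue (Valued.integer (w.1.adicCompletion L)) (Yh 1 0), 0, IsLocalRing.residue (Valued.integer (w.1.adicCompletion L)) (Yh 1 1)] : Matrix (Fin 3) (Fin 3) (Valued.ResidueField (w.1.adicCompletion L)))) *ᵥ (p.elim (Pi.single 2 1) fun q => ![(1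 : Valued.ResidueField (w.1.adicCompletion L)), q.1.1, q.1.2]))))) = ε})
      na nh ca ch hta' hth hκJ.symm
    obtain ⟨r0a, r0h, rε, -⟩ := Trel
    have Tbk := pair_bookkeeping hqN Ha.1 Ha.2 Hh.1 Hh.2 r0a r0h (rε 1 (Or.inl rfl)) (rε (-1) (Or.inr rfl))
    obtain ⟨NE, FP, FM, UP, UM, ⟨e₁, e₂, e₃, e₄⟩, r₁, r₂, r₃⟩ := Tbk
    exact ⟨NE, FP, FM, UP, UM, Or.inr ⟨e₃, e₄, e₁, e₂, hHS⟩, r₁, r₂, r₃⟩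

end Literature.NumberTheory.Rogawski1990.BlockLawPair

end
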